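import Summits.BirchSwinnertonDyer.BirchSwinnertonDyer.Theses.SignedLowerHalves
import Summits.BirchSwinnertonDyer.BirchSwinnertonDyer.Theorems.SignedLowerHalvesKobayashiMainConjectureSmallImageAcnsCrux
import Summits.BirchSwinnertonDyer.BirchSwinnertonDyer.Theorems.SignedLowerHalvesKobayashiMainConjectureSmallImageAcanchorGlueRatRatNotCM
import Summits.BirchSwinnertonDyer.BirchSwinnertonDyer.Theorems.SignedLowerHalvesKobayashiMainConjectureSmallImageHeckePrimeMuThree
import Summits.BirchSwinnertonDyer.BirchSwinnertonDyer.Theorems.SignedLowerHalvesKobayashiMainConjectureSmallImageLemmaPrimeReduction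
import HarnessLib
import Mathlib.NumberTheory.ModularForms.CongruenceSubgroups
import Mathlib.LinearAlgebra.Matrix.SpecialLinearGroup
import Mathlib.Data.ZMod.Basic
import Mathlib.Data.ZMod.Units
import Mathlib.FieldTheory.Finite.Basic
import Literature.NumberTheory.Automorphic.CongruenceSubgroupPropertySL2AwayHolds

/-!
# COMPOSED KERNEL CHECK (ideator bsd-idea-13, gen 10) — NOT a line, NOT registered (W-79):
# LEAD's `Lines/birth_acns.lean` v8 (sha256 7a5efe03…, registered 2026-08-28T14:32Z) VERBATIM, in the renamed namespace
# `…BirthAcnsV8CheckG10`, with the single change that `stub_SpGenerates_three`'s `by sorry` is replaced by the PROOF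
# `EGSpGenerates.stub_SpGenerates_three_holds` (Part I below = `EGSpGenerates_g10.lean` rev 2 verbatim).

RESULT (the `#print axioms` block at the end; farm rc 0, sorries = 6 = the six remaining stubs): `stub_SpGenerates_three`,
`lemmaPrimeThree_of_stubs` and `muOneSignThree_of_stubs` (THEOREM A at p = 3: a 3-adic-unit plus symbol `[u/3^{n+1}]⁺_f` for every
rational non-CM newform attached to a ClassX7-at-3 curve with a₃ = 0, ρ̄₃ non-surjective) depend ONLY on
{propext, Classical.choice, Quot.sound} — no sorry, no hypothesis; `muOneSign_of_stubs` / `KobayashiMainConjectureSmallImage_of` still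
depend on `sorryAx` through the remaining stubs (ES2rat, acDivRat, muOneSign_ns_ge5, publishedInputs, preprintInputs, threeLower).
HONEST SCOPE: BSD / crux 4 NOT proved; no route item closes; this file is a certificate, the LEAD lands the Theorems file.
-/

/-! # Part I — `EGSpGenerates_g10.lean` rev 2 (verbatim body) -/

/-!
# Crux `KobayashiMainConjectureSmallImage` (item stmt-BirchSwinnertonDyer-19002) — ideator bsd-idea-13, gen 10 (rev 2):
# LEAD v8's `stub_SpGenerates_three` (SUBGROUP form (★★) of LEMMA′) — **PROVED OUTRIGHT** (`stub_SpGenerates_three_holds`,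
# axioms {propext, Classical.choice, Quot.sound}): §6 derives it from (VL), §7 DISCHARGES (VL) from the tree's PROVED
# Vaserstein theorem `Literature.NumberTheory.Automorphic.SL2Rel.Away.relG_top_span_natCast_le_relE` (ℤ[1/m], X10b seats).
# (UNREGISTERED workfile, not a line; W-79.  §0–§5 = `EGLemmaPrime_g9.lean` verbatim; §6–§7 are new.)

REV 2 HEADLINE. `theorem stub_SpGenerates_three_holds : <LEAD v8 Lines/birth_acns.lean stub_SpGenerates_three, VERBATIM>` with NO
hypothesis and no sorry; also `spGenerates` / `spGenerates_all` ((★★) for every prime p ∤ N, N ≥ 1), `lemmaPrimeChi` (LEMMA′(N,p) in the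
χ-form of `Theorems.SmallImageLemmaPrimeReduction`, unconditional), `lemmaPrimeHom_holds`, `vasersteinLiehl_holds : VasersteinLiehl p N`.
The composed check `EGTheoremA3v8_g10.lean` (this dir) = v8 VERBATIM with stub 3 := `stub_SpGenerates_three_holds` shows
`muOneSignThree_of_stubs` (THEOREM A at p = 3) depends only on {propext, Classical.choice, Quot.sound}.  The text below up to §6 is the
rev-1 account ((VL) as a hypothesis); §7 removes the hypothesis.

WHAT. LEAD slh-p3 gen 8 registered `Lines/birth_acns.lean` v8 (2026-08-28T14:32Z, sha256 7a5efe03…) whose group-theoretic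
stub is now in SUBGROUP form:

  `stub_SpGenerates_three : ∀ p [Fact p.Prime], p = 3 → ∀ N [NeZero N], ¬ p ∣ N → ∀ γ : Gamma0 N,
      (∃ k, d(γ) ≡ ±p^k in ZMod N) → γ ∈ Subgroup.closure {γ : Gamma0 N | ∃ k, d(γ) = ±p^k}`

(v8 then derives LEMMA′ via the landed `Theorems/…SmallImageLemmaPrimeReduction.lemmaPrime_of_closure_S` (p640975) and
THEOREM A at 3 via the landed Modules 1–3).  Gen 9 (`EGLemmaPrime_g9.lean`) and the critic's glue (V48) reach only the
HOM / χ forms of LEMMA′.  This file proves the SUBGROUP form from the same single hypothesis: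

(VL) [Vaserstein 1972, Mat. Sb. 89; Liehl 1981, J. reine angew. Math. 323; as stated in arXiv:1412.0953 Thm 2.1 and
arXiv:2404.01449 Thm 4.1]: for `A = ℤ[1/p]` and the ideal `N·A`, the group
`G(A, N·A) = {g ∈ SL₂(A) : g ≡ (1 *; 0 1) mod N}` is generated by the elementary matrices `(1 x; 0 1)`, `x ∈ A`,
and `(1 0; y 1)`, `y ∈ N·A`.  Here it is the named Prop `VasersteinLiehl p N` (a HYPOTHESIS, never asserted).

THIS FILE (sorry-free, axioms = {propext, Classical.choice, Quot.sound}):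
  §0–§5  verbatim from `EGLemmaPrime_g9.lean` (sets `S_p`, `Γ′`; coset lemma; `ZInv p = ℤ[1/p]`; `Δ′ ⊇ B⁺, B⁻, ι(Γ′)`;
         (S), (V), `closure(B⁺ ∪ B⁻) = Δ′ ⟸ (VL)`; (T∓) PROVED; `lemmaPrimeHom_of_vasersteinLiehl`);
  §6     NEW: `closure_pPowerCusp_of_VL : VasersteinLiehl p N → TransMinus p N → TransPlus p N →
                ∀ γ : Gamma0 N, ↑γ ∈ Γ′ → γ ∈ closure {δ : Gamma0 N | ↑δ ∈ S_p}`  (closure INSIDE Γ₀(N)),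
         `spGenerates_of_vasersteinLiehl : p.Coprime N → VasersteinLiehl p N → (★★ in v8 coordinates)`  (N ≥ 1),
         `stub_SpGenerates_three_of_vasersteinLiehl : (∀ N, ¬3∣N → VasersteinLiehl 3 N) → <v8 stub_SpGenerates_three VERBATIM>`,
         `spGenerates_all_of_vasersteinLiehl` (every prime p), `lemmaPrimeHom_of_closure` (subgroup form ⇒ hom form).

HONEST SCOPE. Sorry-free. Proves no route item; up to §6 (VL) is a HYPOTHESIS, and §7 PROVES it (`vasersteinLiehl_holds`) from the
tree's Vaserstein theorem, so every statement of this file is a THEOREM (axioms {propext, Classical.choice, Quot.sound}).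
Consequence (kernel, by name; composed check `EGTheoremA3v8_g10.lean`): LEAD's v8 skeleton with `stub_SpGenerates_three :=
stub_SpGenerates_three_holds` has NO open input on its p = 3 ω⁰ branch — `lemmaPrimeThree_of_stubs` and `muOneSignThree_of_stubs`,
i.e. THEOREM A at p = 3 (a 3-adic-unit plus symbol `[u/3^{n+1}]⁺_f`, hence min(μ₃⁺, μ₃⁻) = 0, for every rational non-CM newform
with 3 ∤ N, a₃ = 0, ρ̄₃ non-surjective attached to a ClassX7-at-3 curve), are sorry-free kernel theorems relative to the tree's
definitions.  The p ≥ 5 rider `stub_muOneSign_ns_ge5` and the analytic stubs (ES2, acDiv, published/preprint inputs, threeLower) are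
untouched.  BSD is not proved by this seat; crux 4 (`KobayashiMainConjectureSmallImage`) stays OPEN.
-/

set_option autoImplicit false
set_option linter.unusedVariables false
set_option linter.unusedSectionVars false
set_option linter.dupNamespace false

open scoped MatrixGroups

namespace Summit.BirchSwinnertonDyer.BirchSwinnertonDyer.Cruxes.KobayashiMainConjectureSmallImage.EGSpGenerates

open CongruenceSubgroup Subgroup

/-! ## §0 The sets of `EGSketch_g8` / `EGSymbolStep_g9` (verbatim) -/

/-- `S_p`: elements of `Γ₀(N)` whose lower-right entry is `± p^k`. -/
def pPowerCuspSet (N p : ℕ) : Set SL(2, ℤ) :=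
  {γ | γ ∈ Gamma0 N ∧ ∃ k : ℕ, ((γ : Matrix (Fin 2) (Fin 2) ℤ) 1 1 = (p : ℤ) ^ k ∨
    (γ : Matrix (Fin 2) (Fin 2) ℤ) 1 1 = -((p : ℤ) ^ k))}

/-- `Γ′`: elements of `Γ₀(N)` whose lower-right entry is `≡ ± p^k (mod N)`. -/
def gammaPrimeSet (N p : ℕ) : Set SL(2, ℤ) :=
  {γ | γ ∈ Gamma0 N ∧ ∃ k : ℕ, (((γ : Matrix (Fin 2) (Fin 2) ℤ) 1 1 : ℤ) : ZMod N) = (p : ZMod N) ^ k ∨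
    (((γ : Matrix (Fin 2) (Fin 2) ℤ) 1 1 : ℤ) : ZMod N) = -((p : ZMod N) ^ k)}

/-- LEMMA′ in homomorphism form: a hom to an abelian group killing `S_p` kills `Γ′`. -/
def LemmaPrimeHom (N p : ℕ) : Prop :=
  ∀ (A : Type) [CommGroup A] (ψ : Gamma0 N →* A),
    (∀ γ : Gamma0 N, (γ : SL(2, ℤ)) ∈ pPowerCuspSet N p → ψ γ = 1) →
    ∀ γ : Gamma0 N, (γ : SL(2, ℤ)) ∈ gammaPrimeSet N p → ψ γ = 1

/-! ## §1 The coset lemma (verbatim from `EGCosetLemma.lean`, kernel-checked there; re-proved here) -/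

section Coset

variable {G : Type*} [Group G]

/-- The "big cell" generating set `S = Γ ∩ B⁺·B⁻`. -/
def bigCellSet (Bp Bm Γ : Subgroup G) : Set G :=
  {γ | γ ∈ Γ ∧ ∃ u ∈ Bp, ∃ v ∈ Bm, γ = u * v}

theorem closure_bigCellSet_le (Bp Bm Γ : Subgroup G) : Subgroup.closure (bigCellSet Bp Bm Γ) ≤ Γ :=
  (Subgroup.closure_le _).mpr fun _ h => h.1

/-- One step of the coset walk. -/
theorem step (Bp Bm Γ : Subgroup G)
    (hTm : ∀ g : G, ∃ γ ∈ Γ, ∃ b ∈ Bm, g = γ * b) (hTp : ∀ g : G, ∃ γ ∈ Γ, ∃ b ∈ Bp, g = γ * b)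
    (x y : G) (hy : y ∈ Bp ∨ y ∈ Bm)
    (ih : (∃ h ∈ Subgroup.closure (bigCellSet Bp Bm Γ), h⁻¹ * x ∈ Bm) ∧
      (∃ h ∈ Subgroup.closure (bigCellSet Bp Bm Γ), h⁻¹ * x ∈ Bp)) :
    (∃ h ∈ Subgroup.closure (bigCellSet Bp Bm Γ), h⁻¹ * (x * y) ∈ Bm) ∧
      (∃ h ∈ Subgroup.closure (bigCellSet Bp Bm Γ), h⁻¹ * (x * y) ∈ Bp) := by
  obtain ⟨⟨hm, hhm, hxm⟩, ⟨hp, hhp, hxp⟩⟩ := ih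
  have key : ∀ z : G, (∃ h ∈ Subgroup.closure (bigCellSet Bp Bm Γ), h⁻¹ * z ∈ Bp) →
      (∃ h ∈ Subgroup.closure (bigCellSet Bp Bm Γ), h⁻¹ * z ∈ Bm) := by
    intro z ⟨h, hh, hz⟩
    obtain ⟨γ, hγ, b, hb, hγb⟩ := hTm (h⁻¹ * z)
    -- γ = (h⁻¹ z) b⁻¹ ∈ Γ, and γ = u * v with u = h⁻¹ z ∈ Bp, v = b⁻¹ ∈ Bm: γ ∈ S
    have hγS : γ ∈ bigCellSet Bp Bm Γ := by
      refine ⟨hγ, h⁻¹ * z, hz, b⁻¹, Bm.inv_mem hb, ?_⟩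
      rw [hγb]; group
    refine ⟨h * γ, (Subgroup.closure _).mul_mem hh (Subgroup.subset_closure hγS), ?_⟩
    have : (h * γ)⁻¹ * z = b := by rw [mul_inv_rev, mul_assoc, hγb]; group
    rw [this]; exact hb
  have key' : ∀ z : G, (∃ h ∈ Subgroup.closure (bigCellSet Bp Bm Γ), h⁻¹ * z ∈ Bm) →
      (∃ h ∈ Subgroup.closure (bigCellSet Bp Bm Γ), h⁻¹ * z ∈ Bp) := by
    intro z ⟨h, hh, hz⟩
    obtain ⟨γ, hγ, b, hb, hγb⟩ := hTp (h⁻¹ * z)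
    -- γ⁻¹ = b (h⁻¹ z)⁻¹ = b * (z⁻¹ h): γ⁻¹ ∈ Γ and γ⁻¹ = u v with u = b ∈ Bp, v = (h⁻¹ z)⁻¹ ∈ Bm
    have hγS : γ⁻¹ ∈ bigCellSet Bp Bm Γ := by
      refine ⟨Γ.inv_mem hγ, b, hb, (h⁻¹ * z)⁻¹, Bm.inv_mem hz, ?_⟩
      rw [hγb]; group
    refine ⟨h * γ, (Subgroup.closure _).mul_mem hh ?_, ?_⟩
    · have := (Subgroup.closure (bigCellSet Bp Bm Γ)).inv_mem (Subgroup.subset_closure hγS)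
      rwa [inv_inv] at this
    have : (h * γ)⁻¹ * z = b := by rw [mul_inv_rev, mul_assoc, hγb]; group
    rw [this]; exact hb
  rcases hy with hy | hy
  · -- y ∈ Bp: use the Bp-representative of x
    have hP : ∃ h ∈ Subgroup.closure (bigCellSet Bp Bm Γ), h⁻¹ * (x * y) ∈ Bp :=
      ⟨hp, hhp, by rw [← mul_assoc]; exact Bp.mul_mem hxp hy⟩
    exact ⟨key _ hP, hP⟩
  · have hM : ∃ h ∈ Subgroup.closure (bigCellSet Bp Bm Γ), h⁻¹ * (x * y) ∈ Bm :=
      ⟨hm, hhm, by rw [← mul_assoc]; exact Bm.mul_mem hxm hy⟩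
    exact ⟨hM, key' _ hM⟩

theorem exists_mem_closure_inv_mul_mem (Bp Bm Γ : Subgroup G)
    (hgen : Subgroup.closure ((Bp : Set G) ∪ (Bm : Set G)) = ⊤)
    (hTm : ∀ g : G, ∃ γ ∈ Γ, ∃ b ∈ Bm, g = γ * b) (hTp : ∀ g : G, ∃ γ ∈ Γ, ∃ b ∈ Bp, g = γ * b)
    (g : G) :
    (∃ h ∈ Subgroup.closure (bigCellSet Bp Bm Γ), h⁻¹ * g ∈ Bm) ∧
      (∃ h ∈ Subgroup.closure (bigCellSet Bp Bm Γ), h⁻¹ * g ∈ Bp) := by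
  have hg : g ∈ Subgroup.closure ((Bp : Set G) ∪ (Bm : Set G)) := by rw [hgen]; exact mem_top g
  induction hg using Subgroup.closure_induction_right with
  | one =>
      exact ⟨⟨1, (Subgroup.closure _).one_mem, by simp⟩,
             ⟨1, (Subgroup.closure _).one_mem, by simp⟩⟩
  | mul_right x hx y hy ih => exact step Bp Bm Γ hTm hTp x y hy ih
  | mul_inv_cancel x hx y hy ih =>
      refine step Bp Bm Γ hTm hTp x y⁻¹ ?_ ih
      rcases hy with hy | hy
      · exact Or.inl (Bp.inv_mem hy)
      · exact Or.inr (Bm.inv_mem hy)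

/-- **EG coset lemma** (as in `EGCosetLemma.lean`): if `Γ ∩ B⁻ ≤ Subgroup.closure S` then `Γ = Subgroup.closure S`. -/
theorem eq_closure_bigCellSet (Bp Bm Γ : Subgroup G)
    (hgen : Subgroup.closure ((Bp : Set G) ∪ (Bm : Set G)) = ⊤)
    (hTm : ∀ g : G, ∃ γ ∈ Γ, ∃ b ∈ Bm, g = γ * b)
    (hTp : ∀ g : G, ∃ γ ∈ Γ, ∃ b ∈ Bp, g = γ * b)
    (hstab : Γ ⊓ Bm ≤ Subgroup.closure (bigCellSet Bp Bm Γ)) :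
    Γ = Subgroup.closure (bigCellSet Bp Bm Γ) := by
  refine le_antisymm ?_ (closure_bigCellSet_le Bp Bm Γ)
  intro γ hγ
  obtain ⟨⟨h, hh, hb⟩, -⟩ := exists_mem_closure_inv_mul_mem Bp Bm Γ hgen hTm hTp γ
  have hΓ : h⁻¹ * γ ∈ Γ := Γ.mul_mem (Γ.inv_mem (closure_bigCellSet_le Bp Bm Γ hh)) hγ
  have hH : h⁻¹ * γ ∈ Subgroup.closure (bigCellSet Bp Bm Γ) := hstab ⟨hΓ, hb⟩
  have : γ = h * (h⁻¹ * γ) := by group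
  rw [this]
  exact (Subgroup.closure _).mul_mem hh hH

end Coset

/-! ## §2 The ring `ℤ[1/p] ⊂ ℚ` and the predicates "`∈ N·ℤ[1/p]`", "`≡ ±p^ℤ mod N`" -/

section Ring

variable (p : ℕ) [hp : Fact p.Prime]

/-- `ℤ[1/p]` as a subring of `ℚ`. -/
def ZInv : Subring ℚ where
  carrier := {q | ∃ (n : ℕ) (a : ℤ), q = (a : ℚ) / (p : ℚ) ^ n}
  mul_mem' := by
    rintro x y ⟨n, a, rfl⟩ ⟨m, b, rfl⟩
    refine ⟨n + m, a * b, ?_⟩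
    have hpn : (p : ℚ) ^ n ≠ 0 := pow_ne_zero _ (by exact_mod_cast hp.out.ne_zero)
    have hpm : (p : ℚ) ^ m ≠ 0 := pow_ne_zero _ (by exact_mod_cast hp.out.ne_zero)
    push_cast; rw [pow_add, div_mul_div_comm]
  one_mem' := ⟨0, 1, by simp⟩
  add_mem' := by
    rintro x y ⟨n, a, rfl⟩ ⟨m, b, rfl⟩
    refine ⟨n + m, a * (p : ℤ) ^ m + b * (p : ℤ) ^ n, ?_⟩
    have hpn : (p : ℚ) ^ n ≠ 0 := pow_ne_zero _ (by exact_mod_cast hp.out.ne_zero)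
    have hpm : (p : ℚ) ^ m ≠ 0 := pow_ne_zero _ (by exact_mod_cast hp.out.ne_zero)
    rw [div_add_div _ _ hpn hpm]; push_cast; rw [pow_add]; ring
  zero_mem' := ⟨0, 0, by simp⟩
  neg_mem' := by
    rintro x ⟨n, a, rfl⟩
    exact ⟨n, -a, by push_cast; rw [neg_div]⟩

theorem mem_ZInv_iff (q : ℚ) : q ∈ ZInv p ↔ ∃ (n : ℕ) (a : ℤ), q = (a : ℚ) / (p : ℚ) ^ n := Iff.rfl

theorem intCast_mem_ZInv (a : ℤ) : (a : ℚ) ∈ ZInv p := ⟨0, a, by simp⟩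

theorem pow_inv_mem_ZInv (k : ℕ) : ((p : ℚ) ^ k)⁻¹ ∈ ZInv p := ⟨k, 1, by simp⟩

variable (N : ℕ)

/-- `x ∈ N·ℤ[1/p]`. -/
def InNR (x : ℚ) : Prop := ∃ (n : ℕ) (t : ℤ), x = (N : ℚ) * t / (p : ℚ) ^ n

/-- `x ≡ ± p^ℤ (mod N·ℤ[1/p])`, written without negative exponents: `x·p^k − ε·p^j ∈ N·ℤ[1/p]`. -/
def DCond (x : ℚ) : Prop :=
  ∃ (k j : ℕ) (ε : ℤ), (ε = 1 ∨ ε = -1) ∧ InNR p N (x * (p : ℚ) ^ k - ε * (p : ℚ) ^ j)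

variable {p N}

theorem InNR.zero : InNR p N 0 := ⟨0, 0, by simp⟩

theorem InNR.add {x y : ℚ} (hx : InNR p N x) (hy : InNR p N y) : InNR p N (x + y) := by
  obtain ⟨n, t, rfl⟩ := hx
  obtain ⟨m, s, rfl⟩ := hy
  refine ⟨n + m, t * (p : ℤ) ^ m + s * (p : ℤ) ^ n, ?_⟩
  have hpn : (p : ℚ) ^ n ≠ 0 := pow_ne_zero _ (by exact_mod_cast hp.out.ne_zero)
  have hpm : (p : ℚ) ^ m ≠ 0 := pow_ne_zero _ (by exact_mod_cast hp.out.ne_zero)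
  rw [div_add_div _ _ hpn hpm]; push_cast; rw [pow_add]; ring

theorem InNR.neg {x : ℚ} (hx : InNR p N x) : InNR p N (-x) := by
  obtain ⟨n, t, rfl⟩ := hx
  exact ⟨n, -t, by push_cast; ring⟩

theorem InNR.sub {x y : ℚ} (hx : InNR p N x) (hy : InNR p N y) : InNR p N (x - y) := by
  rw [sub_eq_add_neg]; exact hx.add hy.neg

theorem InNR.mul_mem {x y : ℚ} (hx : InNR p N x) (hy : y ∈ ZInv p) : InNR p N (x * y) := by
  obtain ⟨n, t, rfl⟩ := hx
  obtain ⟨m, a, rfl⟩ := hy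
  refine ⟨n + m, t * a, ?_⟩
  push_cast; rw [pow_add, div_mul_div_comm, mul_assoc]

theorem InNR.mem_mul {x y : ℚ} (hx : x ∈ ZInv p) (hy : InNR p N y) : InNR p N (x * y) := by
  rw [mul_comm]; exact hy.mul_mem hx

theorem InNR.of_dvd {c : ℤ} (h : (N : ℤ) ∣ c) : InNR p N (c : ℚ) := by
  obtain ⟨t, rfl⟩ := h
  exact ⟨0, t, by push_cast; simp⟩

theorem DCond.one : DCond p N 1 := ⟨0, 0, 1, Or.inl rfl, by simpa using (InNR.zero : InNR p N 0)⟩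

theorem DCond.mul {x y : ℚ} (hx : DCond p N x) (hy : DCond p N y) (hxR : x ∈ ZInv p) (hyR : y ∈ ZInv p) :
    DCond p N (x * y) := by
  obtain ⟨k, j, ε, hε, hX⟩ := hx
  obtain ⟨k', j', ε', hε', hY⟩ := hy
  refine ⟨k + k', j + j', ε * ε', ?_, ?_⟩
  · rcases hε with rfl | rfl <;> rcases hε' with rfl | rfl <;> simp
  · -- x y p^{k+k'} − εε' p^{j+j'} = (x p^k − ε p^j)·(y p^{k'}) + ε p^j·(y p^{k'} − ε' p^{j'})
    have h1 : InNR p N ((x * (p : ℚ) ^ k - ε * (p : ℚ) ^ j) * (y * (p : ℚ) ^ k')) :=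
      hX.mul_mem ((ZInv p).mul_mem hyR ((ZInv p).pow_mem (by exact_mod_cast intCast_mem_ZInv p p) k'))
    have h2 : InNR p N ((ε * (p : ℚ) ^ j) * (y * (p : ℚ) ^ k' - ε' * (p : ℚ) ^ j')) :=
      InNR.mem_mul ((ZInv p).mul_mem (by exact_mod_cast intCast_mem_ZInv p ε)
        ((ZInv p).pow_mem (by exact_mod_cast intCast_mem_ZInv p p) j)) hY
    have := h1.add h2
    push_cast
    convert this using 1
    ring

theorem DCond.add_inNR {x n : ℚ} (hx : DCond p N x) (hn : InNR p N n) : DCond p N (x + n) := by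
  obtain ⟨k, j, ε, hε, hX⟩ := hx
  refine ⟨k, j, ε, hε, ?_⟩
  have := hX.add (hn.mul_mem ((ZInv p).pow_mem (by exact_mod_cast intCast_mem_ZInv p p) k))
  convert this using 1
  ring

end Ring

/-! ## §3 `SL₂(ℤ[1/p])`, `Δ′`, `B⁺`, `B⁻`, the embedding `ι : SL₂(ℤ) → SL₂(ℤ[1/p])` -/

section Groups

variable (p : ℕ) [hp : Fact p.Prime] (N : ℕ)

/-- Entry `(i,j)` of `g ∈ SL₂(ℤ[1/p])` as a rational number. -/
def e (g : SL(2, ZInv p)) (i j : Fin 2) : ℚ := (((g : Matrix (Fin 2) (Fin 2) (ZInv p)) i j : ZInv p) : ℚ)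

variable {p}

theorem e_mem (g : SL(2, ZInv p)) (i j : Fin 2) : e p g i j ∈ ZInv p :=
  ((g : Matrix (Fin 2) (Fin 2) (ZInv p)) i j).2

theorem e_mul (g h : SL(2, ZInv p)) (i j : Fin 2) :
    e p (g * h) i j = e p g i 0 * e p h 0 j + e p g i 1 * e p h 1 j := by
  simp only [e, Matrix.SpecialLinearGroup.coe_mul, Matrix.mul_apply, Fin.sum_univ_two, Subring.coe_add,
    Subring.coe_mul]

theorem e_det (g : SL(2, ZInv p)) : e p g 0 0 * e p g 1 1 - e p g 0 1 * e p g 1 0 = 1 := by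
  have h := Matrix.SpecialLinearGroup.det_coe g
  rw [Matrix.det_fin_two] at h
  have h' := congrArg (fun z : ZInv p => (z : ℚ)) h
  simpa [e] using h'

theorem e_inv (g : SL(2, ZInv p)) :
    e p g⁻¹ 0 0 = e p g 1 1 ∧ e p g⁻¹ 0 1 = -e p g 0 1 ∧ e p g⁻¹ 1 0 = -e p g 1 0 ∧ e p g⁻¹ 1 1 = e p g 0 0 := by
  simp only [e, Matrix.SpecialLinearGroup.coe_inv, Matrix.adjugate_fin_two]
  simp

theorem e_one : e p (1 : SL(2, ZInv p)) 0 0 = 1 ∧ e p (1 : SL(2, ZInv p)) 0 1 = 0 ∧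
    e p (1 : SL(2, ZInv p)) 1 0 = 0 ∧ e p (1 : SL(2, ZInv p)) 1 1 = 1 := by
  simp [e]

variable (p)

/-- `Δ′ = {g ∈ SL₂(ℤ[1/p]) : c ∈ N·ℤ[1/p], d ≡ ±p^ℤ (mod N)}`. -/
def DeltaPrime : Subgroup SL(2, ZInv p) where
  carrier := {g | InNR p N (e p g 1 0) ∧ DCond p N (e p g 1 1)}
  mul_mem' := by
    intro g h hg hh
    refine ⟨?_, ?_⟩
    · rw [e_mul]
      exact (hg.1.mul_mem (e_mem h 0 0)).add (InNR.mem_mul (e_mem g 1 1) hh.1)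
    · rw [e_mul, add_comm]
      exact (hg.2.mul hh.2 (e_mem g 1 1) (e_mem h 1 1)).add_inNR (hg.1.mul_mem (e_mem h 0 1))
  one_mem' := by
    refine ⟨?_, ?_⟩
    · rw [e_one.2.2.1]; exact InNR.zero
    · rw [e_one.2.2.2]; exact DCond.one
  inv_mem' := by
    intro g hg
    refine ⟨?_, ?_⟩
    · rw [(e_inv g).2.2.1]; exact hg.1.neg
    · -- d(g⁻¹) = a(g); a p^j − ε p^k = ε(−a·(d p^k − ε p^j) + (ad − 1) p^k), ad − 1 = bc ∈ N·R
      rw [(e_inv g).2.2.2]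
      obtain ⟨k, j, ε, hε, hX⟩ := hg.2
      refine ⟨j, k, ε, hε, ?_⟩
      have hdet := e_det g
      have h1 : InNR p N (-(e p g 0 0) * (e p g 1 1 * (p : ℚ) ^ k - ε * (p : ℚ) ^ j)) :=
        InNR.mem_mul ((ZInv p).neg_mem (e_mem g 0 0)) hX
      have h2 : InNR p N ((e p g 0 1 * e p g 1 0) * (p : ℚ) ^ k) :=
        (InNR.mem_mul (e_mem g 0 1) hg.1).mul_mem
          ((ZInv p).pow_mem (by exact_mod_cast intCast_mem_ZInv p p) k)
      have h3 := (h1.add h2).mul_mem (by exact_mod_cast intCast_mem_ZInv p ε : (ε : ℚ) ∈ ZInv p)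
      have hε2 : (ε : ℚ) * ε = 1 := by rcases hε with rfl | rfl <;> simp
      convert h3 using 1
      linear_combination ((ε : ℚ) * (p : ℚ) ^ k) * hdet + (-(e p g 0 0) * (p : ℚ) ^ j) * hε2

/-- `B⁺`: upper-triangular elements of `SL₂(ℤ[1/p])`. -/
def Bup : Subgroup SL(2, ZInv p) where
  carrier := {g | e p g 1 0 = 0}
  mul_mem' := by
    intro g h hg hh
    show e p (g * h) 1 0 = 0
    rw [e_mul, hg, hh]; ring
  one_mem' := e_one.2.2.1
  inv_mem' := by intro g hg; show e p g⁻¹ 1 0 = 0; rw [(e_inv g).2.2.1, hg, neg_zero]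

/-- `B⁻` (full lower-triangular subgroup of `SL₂(ℤ[1/p])`; intersected with `Δ′` below). -/
def Blo : Subgroup SL(2, ZInv p) where
  carrier := {g | e p g 0 1 = 0}
  mul_mem' := by
    intro g h hg hh
    show e p (g * h) 0 1 = 0
    rw [e_mul, hg, hh]; ring
  one_mem' := e_one.2.1
  inv_mem' := by intro g hg; show e p g⁻¹ 0 1 = 0; rw [(e_inv g).2.1, hg, neg_zero]

/-- The embedding `ι : SL₂(ℤ) → SL₂(ℤ[1/p])`. -/
noncomputable def iota : SL(2, ℤ) →* SL(2, ZInv p) :=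
  Matrix.SpecialLinearGroup.map (Int.castRingHom (ZInv p))

theorem e_iota (γ : SL(2, ℤ)) (i j : Fin 2) : e p (iota p γ) i j = ((γ : Matrix (Fin 2) (Fin 2) ℤ) i j : ℚ) := by
  simp [e, iota, Matrix.SpecialLinearGroup.map, RingHom.mapMatrix_apply, Matrix.map_apply]

theorem iota_injective : Function.Injective (iota p) := by
  intro γ δ h
  ext i j
  have := congrArg (fun g => e p g i j) h
  simp only [e_iota] at this
  exact_mod_cast this

variable {N}

/-- `ι(γ) ∈ Δ′` for `γ ∈ Γ′`. -/
theorem iota_mem_deltaPrime [NeZero N] {γ : SL(2, ℤ)} (hγ : γ ∈ gammaPrimeSet N p) :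
    iota p γ ∈ DeltaPrime p N := by
  obtain ⟨hγ0, k, hk⟩ := hγ
  refine ⟨?_, ?_⟩
  · rw [e_iota]
    apply InNR.of_dvd
    have hc : (((γ : Matrix (Fin 2) (Fin 2) ℤ) 1 0 : ℤ) : ZMod N) = 0 := Gamma0_mem.mp hγ0
    exact (ZMod.intCast_zmod_eq_zero_iff_dvd _ N).mp hc
  · rw [e_iota]
    -- d ≡ ε p^k (mod N): d·p^0 − ε p^k ∈ Nℤ
    have hcases : ∃ ε : ℤ, (ε = 1 ∨ ε = -1) ∧
        (N : ℤ) ∣ ((γ : Matrix (Fin 2) (Fin 2) ℤ) 1 1 : ℤ) - ε * (p : ℤ) ^ k := by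
      rcases hk with h | h
      · refine ⟨1, Or.inl rfl, ?_⟩
        apply (ZMod.intCast_zmod_eq_zero_iff_dvd _ N).mp
        push_cast; rw [h]; ring
      · refine ⟨-1, Or.inr rfl, ?_⟩
        apply (ZMod.intCast_zmod_eq_zero_iff_dvd _ N).mp
        push_cast; rw [h]; ring
    obtain ⟨ε, hε, hdvd⟩ := hcases
    refine ⟨0, k, ε, hε, ?_⟩
    have := InNR.of_dvd (p := p) hdvd
    convert this using 1
    push_cast; ring

end Groups

/-! ## §4 (VL) as a named Prop, transversality Props, and LEMMA′ -/

section Main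

variable (p : ℕ) [hp : Fact p.Prime] (N : ℕ)

/-- The elementary generators: `U(x) = (1 x; 0 1)`, `x ∈ ℤ[1/p]`, and `V(y) = (1 0; y 1)`, `y ∈ N·ℤ[1/p]`. -/
def elemGens : Set SL(2, ZInv p) :=
  {g | e p g 1 0 = 0 ∧ e p g 0 0 = 1 ∧ e p g 1 1 = 1} ∪
  {g | e p g 0 1 = 0 ∧ e p g 0 0 = 1 ∧ e p g 1 1 = 1 ∧ InNR p N (e p g 1 0)}

/-- **(VL) Vaserstein 1972 / Liehl 1981** for `A = ℤ[1/p]`, `I₁ = A`, `I₂ = N·A`: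
`G(A, N·A) = {g : c ∈ N·A, a ≡ d ≡ 1 mod N·A}` is generated by `U(A) ∪ V(N·A)` (the non-trivial inclusion).
[cite: Vaserstein 1972 (Mat. Sb. 89), Liehl 1981 (J. reine angew. Math. 323); arXiv:1412.0953 Thm 2.1;
arXiv:2404.01449 Thm 4.1]  — a HYPOTHESIS below, never asserted. -/
def VasersteinLiehl : Prop :=
  ∀ g : SL(2, ZInv p), InNR p N (e p g 1 0) → InNR p N (e p g 0 0 - 1) → InNR p N (e p g 1 1 - 1) →
    g ∈ Subgroup.closure (elemGens p N)

/-- **(T⁻)** `Δ′ = ι(Γ′)·B⁻`: every `g ∈ Δ′` is `ι(γ)·b` with `γ ∈ Γ′`, `b` lower triangular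
(memo §1: the reduced denominator of `g·0` is prime to `N` and `≡ ±p^ℤ mod N`). -/
def TransMinus : Prop :=
  ∀ g : SL(2, ZInv p), g ∈ DeltaPrime p N →
    ∃ γ : SL(2, ℤ), γ ∈ gammaPrimeSet N p ∧ e p ((iota p γ)⁻¹ * g) 0 1 = 0

/-- **(T⁺)** `Δ′ = ι(Γ′)·B⁺` (memo §1: reduced fraction of `g·∞`). -/
def TransPlus : Prop :=
  ∀ g : SL(2, ZInv p), g ∈ DeltaPrime p N →
    ∃ γ : SL(2, ℤ), γ ∈ gammaPrimeSet N p ∧ e p ((iota p γ)⁻¹ * g) 1 0 = 0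

variable {p N}

/-- An integer which is a unit of `ℤ[1/p]` is `± p^k`. -/
theorem int_eq_pm_pow_of_mul_eq_one {d : ℤ} {y : ℚ} (hy : y ∈ ZInv p) (h : (d : ℚ) * y = 1) :
    ∃ k : ℕ, d = (p : ℤ) ^ k ∨ d = -((p : ℤ) ^ k) := by
  obtain ⟨n, a, rfl⟩ := hy
  have hpn : (p : ℚ) ^ n ≠ 0 := pow_ne_zero _ (by exact_mod_cast hp.out.ne_zero)
  have hda : d * a = (p : ℤ) ^ n := by
    have : (d : ℚ) * a = (p : ℚ) ^ n := by
      field_simp at h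
      linarith [h]
    exact_mod_cast this
  have hdvd : d.natAbs ∣ p ^ n := by
    have : d ∣ (p : ℤ) ^ n := ⟨a, hda.symm⟩
    rw [← Int.natAbs_dvd_natAbs] at this
    simpa [Int.natAbs_pow] using this
  obtain ⟨k, -, hk⟩ := (Nat.dvd_prime_pow hp.out).mp hdvd
  refine ⟨k, ?_⟩
  rcases Int.natAbs_eq d with h' | h'
  · left; rw [h', hk]; push_cast; ring
  · right; rw [h', hk]; push_cast; ring

/-- **(S)**: an element of `Γ₀(N)` that factors as (upper)·(lower) in `SL₂(ℤ[1/p])` has `d = ±p^k`. -/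
theorem mem_pPowerCuspSet_of_factor {γ : SL(2, ℤ)} (hγ : γ ∈ Gamma0 N) {u v : SL(2, ZInv p)}
    (hu : u ∈ Bup p) (hv : v ∈ Blo p) (h : iota p γ = u * v) : γ ∈ pPowerCuspSet N p := by
  refine ⟨hγ, ?_⟩
  -- d(γ) = u₁₁ v₁₁, and u₁₁, v₁₁ are units of ℤ[1/p]
  have hd : ((γ : Matrix (Fin 2) (Fin 2) ℤ) 1 1 : ℚ) = e p u 1 1 * e p v 1 1 := by
    rw [← e_iota (p := p), h, e_mul]
    have hu0 : e p u 1 0 = 0 := hu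
    rw [hu0]; ring
  have hu1 : e p u 0 0 * e p u 1 1 = 1 := by
    have := e_det u; have hu0 : e p u 1 0 = 0 := hu; rw [hu0] at this; linarith
  have hv1 : e p v 0 0 * e p v 1 1 = 1 := by
    have := e_det v; have hv0 : e p v 0 1 = 0 := hv; rw [hv0] at this; linarith
  have hunit : (((γ : Matrix (Fin 2) (Fin 2) ℤ) 1 1 : ℤ) : ℚ) * (e p u 0 0 * e p v 0 0) = 1 := by
    rw [hd]
    calc e p u 1 1 * e p v 1 1 * (e p u 0 0 * e p v 0 0)
        = (e p u 0 0 * e p u 1 1) * (e p v 0 0 * e p v 1 1) := by ring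
      _ = 1 := by rw [hu1, hv1, one_mul]
  exact int_eq_pm_pow_of_mul_eq_one ((ZInv p).mul_mem (e_mem u 0 0) (e_mem v 0 0)) hunit

/-- Transport of `closure` into the subtype `↥Δ′`. -/
theorem mem_closure_subgroupOf {G : Type*} [Group G] (K : Subgroup G) (T : Set K) {x : G}
    (hx : x ∈ Subgroup.closure ((K.subtype) '' T)) (hxK : x ∈ K) :
    (⟨x, hxK⟩ : K) ∈ Subgroup.closure T := by
  rw [← MonoidHom.map_closure] at hx
  obtain ⟨y, hy, hyx⟩ := Subgroup.mem_map.mp hx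
  have : y = ⟨x, hxK⟩ := Subtype.ext (by simpa using hyx)
  rw [← this]; exact hy

/-- `closure(B⁺ ∪ B⁻) = Δ′` inside `Δ′`, from (VL). -/
theorem closure_eq_top_of_VL (hVL : VasersteinLiehl p N) :
    Subgroup.closure ((((Bup p).subgroupOf (DeltaPrime p N)) : Set (DeltaPrime p N)) ∪
      (((Blo p).subgroupOf (DeltaPrime p N)) : Set (DeltaPrime p N))) = ⊤ := by
  classical
  set K := DeltaPrime p N with hK
  set T : Set K := (((Bup p).subgroupOf K) : Set K) ∪ (((Blo p).subgroupOf K) : Set K) with hT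
  rw [eq_top_iff]
  rintro ⟨g, hg⟩ -
  -- the ambient set K.subtype '' T = {x ∈ Δ′ | x ∈ B⁺ ∨ x ∈ B⁻}
  have hTimg : ∀ x : SL(2, ZInv p), x ∈ K → (x ∈ Bup p ∨ x ∈ Blo p) → x ∈ (K.subtype) '' T := by
    intro x hxK hx
    refine ⟨⟨x, hxK⟩, ?_, rfl⟩
    rcases hx with hx | hx
    · exact Or.inl (Subgroup.mem_subgroupOf.mpr hx)
    · exact Or.inr (Subgroup.mem_subgroupOf.mpr hx)
  -- Step 1: the diagonal correction D = diag(x, x⁻¹), x = ε p^j / p^k, lies in B⁺ ∩ Δ′ (indeed in B⁺ ∩ B⁻)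
  obtain ⟨k, j, ε, hε, hX⟩ := hg.2
  have hp0 : (p : ℚ) ≠ 0 := by exact_mod_cast hp.out.ne_zero
  have hεQ : (ε : ℚ) * ε = 1 := by rcases hε with rfl | rfl <;> simp
  -- build D as an element of SL(2, ZInv p)
  let x : ℚ := (ε : ℚ) * (p : ℚ) ^ j / (p : ℚ) ^ k
  let xi : ℚ := (ε : ℚ) * (p : ℚ) ^ k / (p : ℚ) ^ j
  have hxR : x ∈ ZInv p := ⟨k, ε * (p : ℤ) ^ j, by push_cast; rfl⟩
  have hxiR : xi ∈ ZInv p := ⟨j, ε * (p : ℤ) ^ k, by push_cast; rfl⟩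
  have hpk : (p : ℚ) ^ k ≠ 0 := pow_ne_zero _ hp0
  have hpj : (p : ℚ) ^ j ≠ 0 := pow_ne_zero _ hp0
  have hpj' : (p : ℚ) ^ j * ((p : ℚ) ^ j)⁻¹ = 1 := mul_inv_cancel₀ hpj
  have hpk' : (p : ℚ) ^ k * ((p : ℚ) ^ k)⁻¹ = 1 := mul_inv_cancel₀ hpk
  have hxxi : x * xi = 1 := by
    simp only [x, xi, div_eq_mul_inv]
    linear_combination ((p : ℚ) ^ j * ((p : ℚ) ^ j)⁻¹ * ((p : ℚ) ^ k * ((p : ℚ) ^ k)⁻¹)) * hεQ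
      + ((p : ℚ) ^ k * ((p : ℚ) ^ k)⁻¹) * hpj' + hpk'
  let Dm : Matrix (Fin 2) (Fin 2) (ZInv p) := !![⟨x, hxR⟩, 0; 0, ⟨xi, hxiR⟩]
  have hDdet : Dm.det = 1 := by
    rw [Matrix.det_fin_two_of]
    apply Subtype.ext
    show x * xi - 0 * 0 = (1 : ℚ)
    rw [hxxi]; ring
  let D : SL(2, ZInv p) := ⟨Dm, hDdet⟩
  have hD00 : e p D 0 0 = x := rfl
  have hD01 : e p D 0 1 = 0 := rfl
  have hD10 : e p D 1 0 = 0 := rfl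
  have hD11 : e p D 1 1 = xi := rfl
  have hDK : D ∈ K := by
    refine ⟨by rw [hD10]; exact InNR.zero, ?_⟩
    refine ⟨j, k, ε, hε, ?_⟩
    rw [hD11]
    have : xi * (p : ℚ) ^ j - ε * (p : ℚ) ^ k = 0 := by
      simp only [xi]; rw [div_mul_cancel₀ _ hpj]; ring
    rw [this]; exact InNR.zero
  have hDup : D ∈ Bup p := hD10
  -- Step 2: g₁ := D * g lies in G(A, N·A)
  have hg1c : InNR p N (e p (D * g) 1 0) := by
    rw [e_mul, hD10, hD11, zero_mul, zero_add]; exact InNR.mem_mul hxiR hg.1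
  have hg1d : InNR p N (e p (D * g) 1 1 - 1) := by
    rw [e_mul, hD10, hD11, zero_mul, zero_add]
    -- xi·d − 1 = (ε p^k/p^j)·d − 1 = ε/p^j · (d p^k − ε p^j)
    have := hX.mul_mem ((ZInv p).mul_mem (by exact_mod_cast intCast_mem_ZInv p ε : (ε : ℚ) ∈ ZInv p)
      (pow_inv_mem_ZInv p j))
    convert this using 1
    simp only [xi, div_eq_mul_inv]
    linear_combination hεQ + ((ε : ℚ) * ε) * hpj'
  have hg1a : InNR p N (e p (D * g) 0 0 - 1) := by
    -- a₁ − 1 = (a₁ d₁ − 1) − a₁ (d₁ − 1) = b₁ c₁ − a₁ (d₁ − 1)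
    have hdet := e_det (D * g)
    have h1 : InNR p N (e p (D * g) 0 1 * e p (D * g) 1 0) := InNR.mem_mul (e_mem _ 0 1) hg1c
    have h2 : InNR p N (e p (D * g) 0 0 * (e p (D * g) 1 1 - 1)) := InNR.mem_mul (e_mem _ 0 0) hg1d
    have := h1.sub h2
    convert this using 1
    linarith
  have hg1 : D * g ∈ Subgroup.closure (elemGens p N) := hVL (D * g) hg1c hg1a hg1d
  -- Step 3: elemGens ⊆ K.subtype '' T, and D ∈ K.subtype '' T
  have hsub : elemGens p N ⊆ (K.subtype) '' T := by
    intro y hy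
    rcases hy with ⟨hy10, hy00, hy11⟩ | ⟨hy01, hy00, hy11, hyc⟩
    · refine hTimg y ⟨by rw [hy10]; exact InNR.zero, by rw [hy11]; exact DCond.one⟩ (Or.inl hy10)
    · refine hTimg y ⟨hyc, by rw [hy11]; exact DCond.one⟩ (Or.inr hy01)
  have hg1' : D * g ∈ Subgroup.closure ((K.subtype) '' T) := Subgroup.closure_mono hsub hg1
  have hDT : D ∈ Subgroup.closure ((K.subtype) '' T) := Subgroup.subset_closure (hTimg D hDK (Or.inl hDup))
  have hgT : g ∈ Subgroup.closure ((K.subtype) '' T) := by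
    have := (Subgroup.closure ((K.subtype) '' T)).mul_mem ((Subgroup.closure _).inv_mem hDT) hg1'
    rwa [← mul_assoc, inv_mul_cancel, one_mul] at this
  exact mem_closure_subgroupOf K T hgT hg

/-- **LEMMA′ from (VL) + (T⁻) + (T⁺)** via the coset lemma. -/
theorem lemmaPrimeHom_of_VL [NeZero N] (hVL : VasersteinLiehl p N) (hTm : TransMinus p N)
    (hTp : TransPlus p N) : LemmaPrimeHom N p := by
  classical
  intro A _ ψ hψ γ hγ
  set K := DeltaPrime p N with hK
  let Bp : Subgroup K := (Bup p).subgroupOf K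
  let Bm : Subgroup K := (Blo p).subgroupOf K
  -- Γ := ι(Γ′) ∩ Δ′ as a subgroup of K: we use the image of the SUBGROUP generated by Γ′ inside SL₂(ℤ);
  -- to stay elementary we take GamZ := closure (gammaPrimeSet N p) and Γ := (GamZ.map ι).subgroupOf K.
  let GamZ : Subgroup SL(2, ℤ) := Subgroup.closure (gammaPrimeSet N p)
  let Γ : Subgroup K := (GamZ.map (iota p)).subgroupOf K
  -- Γ′ is itself a subgroup of SL₂(ℤ): closure adds nothing we need, because every element of the closure
  -- that we evaluate ψ on comes with a witness in Γ₀(N) (closure induction below).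
  -- (1) hgen
  have hgen : Subgroup.closure ((Bp : Set K) ∪ (Bm : Set K)) = ⊤ := closure_eq_top_of_VL hVL
  -- (2) hTm / hTp in the subtype
  have hTm' : ∀ g : K, ∃ γ' ∈ Γ, ∃ b ∈ Bm, g = γ' * b := by
    rintro ⟨g, hg⟩
    obtain ⟨γ₀, hγ₀, hb⟩ := hTm g hg
    have hιK : iota p γ₀ ∈ K := iota_mem_deltaPrime p hγ₀
    refine ⟨⟨iota p γ₀, hιK⟩, ?_, ⟨(iota p γ₀)⁻¹ * g, K.mul_mem (K.inv_mem hιK) hg⟩, ?_, ?_⟩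
    · exact Subgroup.mem_subgroupOf.mpr (Subgroup.mem_map.mpr ⟨γ₀, Subgroup.subset_closure hγ₀, rfl⟩)
    · exact Subgroup.mem_subgroupOf.mpr hb
    · apply Subtype.ext; simp
  have hTp' : ∀ g : K, ∃ γ' ∈ Γ, ∃ b ∈ Bp, g = γ' * b := by
    rintro ⟨g, hg⟩
    obtain ⟨γ₀, hγ₀, hb⟩ := hTp g hg
    have hιK : iota p γ₀ ∈ K := iota_mem_deltaPrime p hγ₀
    refine ⟨⟨iota p γ₀, hιK⟩, ?_, ⟨(iota p γ₀)⁻¹ * g, K.mul_mem (K.inv_mem hιK) hg⟩, ?_, ?_⟩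
    · exact Subgroup.mem_subgroupOf.mpr (Subgroup.mem_map.mpr ⟨γ₀, Subgroup.subset_closure hγ₀, rfl⟩)
    · exact Subgroup.mem_subgroupOf.mpr hb
    · apply Subtype.ext; simp
  -- (3) hstab: Γ ∩ B⁻ ⊆ S (take u = 1)
  have hstab : Γ ⊓ Bm ≤ Subgroup.closure (bigCellSet Bp Bm Γ) := by
    intro x hx
    apply Subgroup.subset_closure
    exact ⟨hx.1, 1, Bp.one_mem, x, hx.2, by rw [one_mul]⟩
  -- (4) the coset lemma
  have hEq : Γ = Subgroup.closure (bigCellSet Bp Bm Γ) := eq_closure_bigCellSet Bp Bm Γ hgen hTm' hTp' hstab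
  -- (5) every element of Γ₀(N) in Γ₀(N) ∩ GamZ ... we show: ∀ x ∈ closure S, ∀ δ ∈ Γ₀(N), ι δ = x → ψ δ = 1,
  --     via the predicate P x := ∃ δ : Gamma0 N, ι δ = x ∧ ψ δ = 1, and injectivity of ι.
  have hP : ∀ x : K, x ∈ Subgroup.closure (bigCellSet Bp Bm Γ) →
      ∃ δ : Gamma0 N, iota p (δ : SL(2, ℤ)) = (x : SL(2, ZInv p)) ∧ ψ δ = 1 := by
    intro x hx
    induction hx using Subgroup.closure_induction with
    | mem y hy =>
        obtain ⟨hyΓ, u, hu, v, hv, hyuv⟩ := hy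
        -- y ∈ Γ: y = ι δ₀ with δ₀ ∈ GamZ; but we need δ₀ ∈ Γ₀(N) with d = ±p^k. Every element of GamZ is in
        -- Γ₀(N) (closure of a subset of the subgroup Γ₀(N)).
        obtain ⟨δ₀, hδ₀, hδ₀y⟩ := Subgroup.mem_map.mp (Subgroup.mem_subgroupOf.mp hyΓ)
        have hδ₀Γ0 : δ₀ ∈ Gamma0 N := by
          have : GamZ ≤ Gamma0 N := (Subgroup.closure_le _).mpr (fun z hz => hz.1)
          exact this hδ₀
        have hfac : iota p δ₀ = (u : SL(2, ZInv p)) * (v : SL(2, ZInv p)) := by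
          rw [hδ₀y, hyuv]; rfl
        have hS : δ₀ ∈ pPowerCuspSet N p :=
          mem_pPowerCuspSet_of_factor hδ₀Γ0 (Subgroup.mem_subgroupOf.mp hu) (Subgroup.mem_subgroupOf.mp hv) hfac
        exact ⟨⟨δ₀, hδ₀Γ0⟩, hδ₀y, hψ ⟨δ₀, hδ₀Γ0⟩ hS⟩
    | one => exact ⟨1, by simp, map_one ψ⟩
    | mul y z hy hz ihy ihz =>
        obtain ⟨δ₁, h₁, hψ₁⟩ := ihy
        obtain ⟨δ₂, h₂, hψ₂⟩ := ihz
        refine ⟨δ₁ * δ₂, ?_, by rw [map_mul, hψ₁, hψ₂, one_mul]⟩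
        rw [Subgroup.coe_mul, map_mul, h₁, h₂]; rfl
    | inv y hy ihy =>
        obtain ⟨δ₁, h₁, hψ₁⟩ := ihy
        refine ⟨δ₁⁻¹, ?_, by rw [map_inv, hψ₁, inv_one]⟩
        rw [Subgroup.coe_inv, map_inv, h₁]; rfl
  -- (6) conclude for γ
  have hγK : iota p (γ : SL(2, ℤ)) ∈ K := iota_mem_deltaPrime p hγ
  have hγΓ : (⟨iota p (γ : SL(2, ℤ)), hγK⟩ : K) ∈ Γ :=
    Subgroup.mem_subgroupOf.mpr (Subgroup.mem_map.mpr ⟨γ, Subgroup.subset_closure hγ, rfl⟩)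
  rw [hEq] at hγΓ
  obtain ⟨δ, hδ, hψδ⟩ := hP _ hγΓ
  have : δ = γ := by
    apply Subtype.ext
    exact iota_injective p hδ
  rw [← this]; exact hψδ

end Main

/-! ## §5 Transversality (T⁻), (T⁺): elementary number theory (memo §1), now PROVED -/

section Trans

variable {p : ℕ} [hp : Fact p.Prime] {N : ℕ}

/-- `DCond` also holds for the upper-left entry of an element of `Δ′`. -/
theorem dcond_fst {g : SL(2, ZInv p)} (hg : g ∈ DeltaPrime p N) : DCond p N (e p g 0 0) := by
  have h := ((DeltaPrime p N).inv_mem hg).2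
  rwa [(e_inv g).2.2.2] at h

/-- Common `p`-power denominator for the four entries. -/
theorem exists_common_denom (g : SL(2, ZInv p)) :
    ∃ (M : ℕ) (A B C D : ℤ), e p g 0 0 = A / (p : ℚ) ^ M ∧ e p g 0 1 = B / (p : ℚ) ^ M ∧
      e p g 1 0 = C / (p : ℚ) ^ M ∧ e p g 1 1 = D / (p : ℚ) ^ M := by
  have hp0 : (p : ℚ) ≠ 0 := by exact_mod_cast hp.out.ne_zero
  have resc : ∀ (x : ℚ) (n : ℕ) (a : ℤ), x = a / (p : ℚ) ^ n → ∀ m : ℕ,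
      x = ((a * (p : ℤ) ^ m : ℤ) : ℚ) / (p : ℚ) ^ (n + m) := by
    intro x n a hx m
    rw [hx, pow_add]; push_cast
    rw [mul_div_mul_right _ _ (pow_ne_zero m hp0)]
  obtain ⟨n₁, a₁, h₁⟩ := (mem_ZInv_iff p _).mp (e_mem g 0 0)
  obtain ⟨n₂, a₂, h₂⟩ := (mem_ZInv_iff p _).mp (e_mem g 0 1)
  obtain ⟨n₃, a₃, h₃⟩ := (mem_ZInv_iff p _).mp (e_mem g 1 0)
  obtain ⟨n₄, a₄, h₄⟩ := (mem_ZInv_iff p _).mp (e_mem g 1 1)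
  refine ⟨n₁ + n₂ + n₃ + n₄, a₁ * (p : ℤ) ^ (n₂ + n₃ + n₄), a₂ * (p : ℤ) ^ (n₁ + n₃ + n₄),
    a₃ * (p : ℤ) ^ (n₁ + n₂ + n₄), a₄ * (p : ℤ) ^ (n₁ + n₂ + n₃), ?_, ?_, ?_, ?_⟩
  · rw [show n₁ + n₂ + n₃ + n₄ = n₁ + (n₂ + n₃ + n₄) by ring]; exact resc _ _ _ h₁ _
  · rw [show n₁ + n₂ + n₃ + n₄ = n₂ + (n₁ + n₃ + n₄) by ring]; exact resc _ _ _ h₂ _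
  · rw [show n₁ + n₂ + n₃ + n₄ = n₃ + (n₁ + n₂ + n₄) by ring]; exact resc _ _ _ h₃ _
  · rw [show n₁ + n₂ + n₃ + n₄ = n₄ + (n₁ + n₂ + n₃) by ring]; exact resc _ _ _ h₄ _

/-- Integral determinant `A D − B C = p^{2M}`. -/
theorem det_int {g : SL(2, ZInv p)} {M : ℕ} {A B C D : ℤ} (ha : e p g 0 0 = A / (p : ℚ) ^ M)
    (hb : e p g 0 1 = B / (p : ℚ) ^ M) (hc : e p g 1 0 = C / (p : ℚ) ^ M)
    (hd : e p g 1 1 = D / (p : ℚ) ^ M) : A * D - B * C = (p : ℤ) ^ (2 * M) := by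
  have hp0 : (p : ℚ) ≠ 0 := by exact_mod_cast hp.out.ne_zero
  have hPM : (p : ℚ) ^ M * ((p : ℚ) ^ M)⁻¹ = 1 := mul_inv_cancel₀ (pow_ne_zero M hp0)
  have hdet := e_det g
  rw [ha, hb, hc, hd] at hdet
  simp only [div_eq_mul_inv] at hdet
  have hQ : (A : ℚ) * D - B * C = (p : ℚ) ^ (2 * M) := by
    rw [pow_mul', sq]
    linear_combination ((p : ℚ) ^ M * (p : ℚ) ^ M) * hdet
      - ((A : ℚ) * D - B * C) * (((p : ℚ) ^ M)⁻¹ * (p : ℚ) ^ M + 1) * hPM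
  exact_mod_cast hQ

/-- The gcd of two of the integral numerators divides `p^{2M}`, hence is a power of `p`. -/
theorem gcd_eq_prime_pow {X Y : ℤ} {M : ℕ} (h : (Int.gcd X Y : ℤ) ∣ (p : ℤ) ^ (2 * M)) :
    ∃ i : ℕ, Int.gcd X Y = p ^ i := by
  have h' : Int.gcd X Y ∣ p ^ (2 * M) := by
    have : ((Int.gcd X Y : ℕ) : ℤ) ∣ ((p ^ (2 * M) : ℕ) : ℤ) := by push_cast; exact h
    exact Int.natCast_dvd_natCast.mp this
  obtain ⟨i, -, hi⟩ := (Nat.dvd_prime_pow hp.out).mp h'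
  exact ⟨i, hi⟩

/-- `(p : ZMod N)^e` has an inverse which is again a power of `p`. -/
theorem exists_pow_mul_pow_eq_one [NeZero N] (hpN : Nat.Coprime p N) (e₀ : ℕ) :
    ∃ e' : ℕ, (p : ZMod N) ^ e₀ * (p : ZMod N) ^ e' = 1 := by
  have hφ : 0 < Nat.totient N := Nat.totient_pos.mpr (NeZero.pos N)
  obtain ⟨m, hm⟩ : ∃ m : ℕ, Nat.totient N = m + 1 := ⟨Nat.totient N - 1, by omega⟩
  refine ⟨e₀ * m, ?_⟩
  have hu : (p : ZMod N) ^ Nat.totient N = 1 := by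
    have h1 := ZMod.pow_totient (ZMod.unitOfCoprime p hpN)
    rw [Units.ext_iff, Units.val_pow_eq_pow_val, ZMod.coe_unitOfCoprime, Units.val_one] at h1
    exact h1
  rw [← pow_add, show e₀ + e₀ * m = Nat.totient N * e₀ by rw [hm]; ring, pow_mul, hu, one_pow]

/-- From `v · p^{e₂} = ε · p^{e₁}` in `ZMod N` (`ε = ±1`): `v ≡ ± p^K`. -/
theorem zmod_eq_pm_pow [NeZero N] (hpN : Nat.Coprime p N) {v ε : ℤ} (hε : ε = 1 ∨ ε = -1)
    {e₁ e₂ : ℕ} (h : (v : ZMod N) * (p : ZMod N) ^ e₂ = (ε : ZMod N) * (p : ZMod N) ^ e₁) :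
    ∃ K : ℕ, (v : ZMod N) = (p : ZMod N) ^ K ∨ (v : ZMod N) = -((p : ZMod N) ^ K) := by
  obtain ⟨e', he'⟩ := exists_pow_mul_pow_eq_one hpN e₂
  refine ⟨e₁ + e', ?_⟩
  have hv : (v : ZMod N) = (ε : ZMod N) * (p : ZMod N) ^ (e₁ + e') := by
    calc (v : ZMod N) = (v : ZMod N) * ((p : ZMod N) ^ e₂ * (p : ZMod N) ^ e') := by
            rw [he', mul_one]
      _ = ((v : ZMod N) * (p : ZMod N) ^ e₂) * (p : ZMod N) ^ e' := by ring
      _ = (ε : ZMod N) * (p : ZMod N) ^ (e₁ + e') := by rw [h, pow_add]; ring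
  rcases hε with rfl | rfl
  · left; rw [hv]; push_cast; ring
  · right; rw [hv]; push_cast; ring

theorem isUnit_zmod_of_eq_pm_pow (hpN : Nat.Coprime p N) {v : ℤ} {K : ℕ}
    (h : (v : ZMod N) = (p : ZMod N) ^ K ∨ (v : ZMod N) = -((p : ZMod N) ^ K)) :
    IsUnit (v : ZMod N) := by
  have hu : IsUnit ((p : ZMod N) ^ K) := by
    have : IsUnit (p : ZMod N) := by
      rw [← ZMod.coe_unitOfCoprime p hpN]; exact Units.isUnit _
    exact this.pow K
  rcases h with h | h
  · rw [h]; exact hu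
  · rw [h]; exact hu.neg

/-- Clearing denominators: from `X/p^M · p^k − ε·p^j ∈ N·ℤ[1/p]`,
`X · p^{k+n'} = ε · p^{j+M+n'}` in `ZMod N` for some `n'`. -/
theorem zmod_congr_of_inNR {X : ℤ} {M k j : ℕ} {ε : ℤ}
    (h : InNR p N ((X : ℚ) / (p : ℚ) ^ M * (p : ℚ) ^ k - ε * (p : ℚ) ^ j)) :
    ∃ n' : ℕ, (X : ZMod N) * (p : ZMod N) ^ (k + n') = (ε : ZMod N) * (p : ZMod N) ^ (j + M + n') := by
  obtain ⟨n', t', hX⟩ := h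
  refine ⟨n', ?_⟩
  have hp0 : (p : ℚ) ≠ 0 := by exact_mod_cast hp.out.ne_zero
  have hPM : (p : ℚ) ^ M * ((p : ℚ) ^ M)⁻¹ = 1 := mul_inv_cancel₀ (pow_ne_zero M hp0)
  have hPn : (p : ℚ) ^ n' * ((p : ℚ) ^ n')⁻¹ = 1 := mul_inv_cancel₀ (pow_ne_zero n' hp0)
  have hQ : (X : ℚ) * (p : ℚ) ^ k * (p : ℚ) ^ n' - (ε : ℚ) * (p : ℚ) ^ j * (p : ℚ) ^ M * (p : ℚ) ^ n'
      = (N : ℚ) * t' * (p : ℚ) ^ M := by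
    simp only [div_eq_mul_inv] at hX
    linear_combination ((p : ℚ) ^ M * (p : ℚ) ^ n') * hX
      - ((X : ℚ) * (p : ℚ) ^ k * (p : ℚ) ^ n') * hPM + ((N : ℚ) * t' * (p : ℚ) ^ M) * hPn
  have hZ : X * (p : ℤ) ^ k * (p : ℤ) ^ n' - ε * (p : ℤ) ^ j * (p : ℤ) ^ M * (p : ℤ) ^ n'
      = (N : ℤ) * t' * (p : ℤ) ^ M := by
    exact_mod_cast hQ
  have hmod := congrArg (fun z : ℤ => (z : ZMod N)) hZ
  push_cast at hmod
  simp only [ZMod.natCast_self, zero_mul] at hmod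
  rw [pow_add, show j + M + n' = j + (M + n') by ring, pow_add, pow_add]
  linear_combination hmod

/-- An `SL₂(ℤ)` element with prescribed coprime first column. -/
theorem exists_SL2_col (u v : ℤ) (h : IsCoprime u v) :
    ∃ γ : SL(2, ℤ), (γ : Matrix (Fin 2) (Fin 2) ℤ) 0 0 = u ∧ (γ : Matrix (Fin 2) (Fin 2) ℤ) 1 0 = v := by
  obtain ⟨x, y, hxy⟩ := h
  exact ⟨⟨!![u, -y; v, x], by rw [Matrix.det_fin_two_of]; linear_combination hxy⟩, rfl, rfl⟩

/-- A `Γ₀(N)` element with prescribed second column `(s, t)`, `t` coprime to `sN`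
(as `EGSymbolStep_g9.exists_gamma0_entries`). -/
theorem exists_gamma0_entries (s t : ℤ) (h : IsCoprime t (s * N)) :
    ∃ γ : SL(2, ℤ), γ ∈ Gamma0 N ∧ (γ : Matrix (Fin 2) (Fin 2) ℤ) 0 1 = s ∧
      (γ : Matrix (Fin 2) (Fin 2) ℤ) 1 1 = t := by
  obtain ⟨u, w, huw⟩ := h
  refine ⟨⟨!![u, s; -(w * N), t], by rw [Matrix.det_fin_two_of]; linear_combination huw⟩, ?_, rfl, rfl⟩
  rw [Gamma0_mem]
  show (((-(w * (N : ℤ))) : ℤ) : ZMod N) = 0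
  push_cast
  simp

theorem e_iota_inv_mul_01 (γ : SL(2, ℤ)) (g : SL(2, ZInv p)) :
    e p ((iota p γ)⁻¹ * g) 0 1 = ((γ : Matrix (Fin 2) (Fin 2) ℤ) 1 1 : ℚ) * e p g 0 1
      - ((γ : Matrix (Fin 2) (Fin 2) ℤ) 0 1 : ℚ) * e p g 1 1 := by
  rw [e_mul, (e_inv _).1, (e_inv _).2.1, e_iota, e_iota]; ring

theorem e_iota_inv_mul_10 (γ : SL(2, ℤ)) (g : SL(2, ZInv p)) :
    e p ((iota p γ)⁻¹ * g) 1 0 = -((γ : Matrix (Fin 2) (Fin 2) ℤ) 1 0 : ℚ) * e p g 0 0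
      + ((γ : Matrix (Fin 2) (Fin 2) ℤ) 0 0 : ℚ) * e p g 1 0 := by
  rw [e_mul, (e_inv _).2.2.1, (e_inv _).2.2.2, e_iota, e_iota]

/-- **(T⁻)** proved: `Δ′ = ι(Γ′)·B⁻`. -/
theorem transMinus_holds [NeZero N] (hpN : Nat.Coprime p N) : TransMinus p N := by
  intro g hg
  have hpz : (p : ℤ) ≠ 0 := by exact_mod_cast hp.out.ne_zero
  obtain ⟨M, A, B, C, D, ha, hb, hc, hd⟩ := exists_common_denom g
  have hdet := det_int ha hb hc hd
  -- g₀ := gcd(B, D) > 0 and a power of p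
  have hg0 : 0 < Int.gcd B D := by
    rw [Int.gcd_pos_iff]
    by_contra h0
    simp only [not_or, not_ne_iff] at h0
    have : (p : ℤ) ^ (2 * M) = 0 := by rw [← hdet, h0.1, h0.2]; ring
    exact pow_ne_zero _ hpz this
  have hdvd : (Int.gcd B D : ℤ) ∣ (p : ℤ) ^ (2 * M) := by
    rw [← hdet]
    exact dvd_sub (dvd_mul_of_dvd_right (Int.gcd_dvd_right ..) _)
      (dvd_mul_of_dvd_left (Int.gcd_dvd_left ..) _)
  obtain ⟨i, hi⟩ := gcd_eq_prime_pow hdvd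
  obtain ⟨u, v, huv, hBu, hDv⟩ := Int.exists_gcd_one hg0
  have hgi : ((Int.gcd B D : ℕ) : ℤ) = (p : ℤ) ^ i := by rw [hi]; push_cast; rfl
  rw [hgi] at hBu hDv
  -- the congruence for D from DCond(d)
  have hg' : InNR p N (e p g 1 0) ∧ DCond p N (e p g 1 1) := hg
  obtain ⟨-, k, j, ε, hε, hX⟩ := hg'
  rw [hd] at hX
  obtain ⟨n', hmod⟩ := zmod_congr_of_inNR hX
  -- v · p^{i+k+n'} = ε · p^{j+M+n'}
  have hv : (v : ZMod N) * (p : ZMod N) ^ (i + (k + n')) = (ε : ZMod N) * (p : ZMod N) ^ (j + M + n') := by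
    rw [← hmod, hDv]; push_cast; ring
  obtain ⟨K, hK⟩ := zmod_eq_pm_pow hpN hε hv
  -- coprimality and the Γ₀(N) element with second column (u, v)
  have hvN : IsCoprime v (N : ℤ) :=
    ((ZMod.coe_int_isUnit_iff_isCoprime v N).mp (isUnit_zmod_of_eq_pm_pow hpN hK)).symm
  have hvu : IsCoprime v u := (Int.isCoprime_iff_gcd_eq_one.mpr huv).symm
  obtain ⟨γ, hγ0, hγ01, hγ11⟩ := exists_gamma0_entries (N := N) u v (hvu.mul_right hvN)
  refine ⟨γ, ⟨hγ0, K, ?_⟩, ?_⟩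
  · rw [hγ11]; exact hK
  · rw [e_iota_inv_mul_01, hγ01, hγ11, hb, hd, hBu, hDv]
    push_cast; ring

/-- **(T⁺)** proved: `Δ′ = ι(Γ′)·B⁺`. -/
theorem transPlus_holds [NeZero N] (hpN : Nat.Coprime p N) : TransPlus p N := by
  intro g hg
  have hpz : (p : ℤ) ≠ 0 := by exact_mod_cast hp.out.ne_zero
  obtain ⟨M, A, B, C, D, ha, hb, hc, hd⟩ := exists_common_denom g
  have hdet := det_int ha hb hc hd
  -- g₀ := gcd(A, C) > 0 and a power of p
  have hg0 : 0 < Int.gcd A C := by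
    rw [Int.gcd_pos_iff]
    by_contra h0
    simp only [not_or, not_ne_iff] at h0
    have : (p : ℤ) ^ (2 * M) = 0 := by rw [← hdet, h0.1, h0.2]; ring
    exact pow_ne_zero _ hpz this
  have hdvd : (Int.gcd A C : ℤ) ∣ (p : ℤ) ^ (2 * M) := by
    rw [← hdet]
    exact dvd_sub (dvd_mul_of_dvd_left (Int.gcd_dvd_left ..) _)
      (dvd_mul_of_dvd_right (Int.gcd_dvd_right ..) _)
  obtain ⟨i, hi⟩ := gcd_eq_prime_pow hdvd
  obtain ⟨u, v, huv, hAu, hCv⟩ := Int.exists_gcd_one hg0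
  have hgi : ((Int.gcd A C : ℕ) : ℤ) = (p : ℤ) ^ i := by rw [hi]; push_cast; rfl
  rw [hgi] at hAu hCv
  have hg' : InNR p N (e p g 1 0) ∧ DCond p N (e p g 1 1) := hg
  -- N ∣ v : from c ∈ N·ℤ[1/p]
  have hvN : (v : ZMod N) = 0 := by
    obtain ⟨n, t, hct⟩ := hg'.1
    -- C · p^n ≡ 0: reuse `zmod_congr_of_inNR` with k = 0? Direct computation instead:
    have hp0 : (p : ℚ) ≠ 0 := by exact_mod_cast hp.out.ne_zero
    have hPM : (p : ℚ) ^ M * ((p : ℚ) ^ M)⁻¹ = 1 := mul_inv_cancel₀ (pow_ne_zero M hp0)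
    have hPn : (p : ℚ) ^ n * ((p : ℚ) ^ n)⁻¹ = 1 := mul_inv_cancel₀ (pow_ne_zero n hp0)
    rw [hc] at hct
    have hQ : (C : ℚ) * (p : ℚ) ^ n = (N : ℚ) * t * (p : ℚ) ^ M := by
      simp only [div_eq_mul_inv] at hct
      linear_combination ((p : ℚ) ^ M * (p : ℚ) ^ n) * hct - ((C : ℚ) * (p : ℚ) ^ n) * hPM
        + ((N : ℚ) * t * (p : ℚ) ^ M) * hPn
    have hZ : C * (p : ℤ) ^ n = (N : ℤ) * t * (p : ℤ) ^ M := by exact_mod_cast hQ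
    have hmod := congrArg (fun z : ℤ => (z : ZMod N)) hZ
    push_cast at hmod
    simp only [ZMod.natCast_self, zero_mul] at hmod
    rw [hCv] at hmod
    push_cast at hmod
    -- hmod : v * p^i * p^n = 0 ; p is a unit
    have hu : IsUnit ((p : ZMod N) ^ i * (p : ZMod N) ^ n) := by
      have : IsUnit (p : ZMod N) := by
        rw [← ZMod.coe_unitOfCoprime p hpN]; exact Units.isUnit _
      exact (this.pow i).mul (this.pow n)
    have h2 : (v : ZMod N) * ((p : ZMod N) ^ i * (p : ZMod N) ^ n) = 0 := by
      rw [← mul_assoc]; exact hmod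
    exact (IsUnit.mul_left_eq_zero hu).mp h2
  -- u ≡ ± p^K from DCond(a)
  obtain ⟨k, j, ε, hε, hX⟩ := dcond_fst hg
  rw [ha] at hX
  obtain ⟨n', hmodA⟩ := zmod_congr_of_inNR hX
  have hu' : (u : ZMod N) * (p : ZMod N) ^ (i + (k + n')) = (ε : ZMod N) * (p : ZMod N) ^ (j + M + n') := by
    rw [← hmodA, hAu]; push_cast; ring
  obtain ⟨K, hK⟩ := zmod_eq_pm_pow hpN hε hu'
  -- the SL₂(ℤ) element with first column (u, v); it lies in Γ₀(N) since N ∣ v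
  have huv' : IsCoprime u v := Int.isCoprime_iff_gcd_eq_one.mpr huv
  obtain ⟨γ, hγ00, hγ10⟩ := exists_SL2_col u v huv'
  have hγ0 : γ ∈ Gamma0 N := by rw [Gamma0_mem, hγ10]; exact hvN
  -- its lower-right entry: u · γ₁₁ ≡ 1, so γ₁₁ ≡ ± p^{K'}
  have hdetγ : (γ : Matrix (Fin 2) (Fin 2) ℤ) 0 0 * (γ : Matrix (Fin 2) (Fin 2) ℤ) 1 1
      - (γ : Matrix (Fin 2) (Fin 2) ℤ) 0 1 * (γ : Matrix (Fin 2) (Fin 2) ℤ) 1 0 = 1 := by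
    have := Matrix.SpecialLinearGroup.det_coe γ
    rwa [Matrix.det_fin_two] at this
  have h11 : ((γ : Matrix (Fin 2) (Fin 2) ℤ) 1 1 : ZMod N) * (u : ZMod N) = 1 := by
    have hm := congrArg (fun z : ℤ => (z : ZMod N)) hdetγ
    push_cast at hm
    rw [hγ00, hγ10, hvN, mul_zero, sub_zero] at hm
    rw [mul_comm]; exact hm
  have hεε : (ε : ZMod N) * (ε : ZMod N) = 1 := by rcases hε with rfl | rfl <;> push_cast <;> ring
  have hK' : ∃ ε' : ℤ, (ε' = 1 ∨ ε' = -1) ∧ (u : ZMod N) = (ε' : ZMod N) * (p : ZMod N) ^ K := by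
    rcases hK with h | h
    · exact ⟨1, Or.inl rfl, by rw [h]; push_cast; ring⟩
    · exact ⟨-1, Or.inr rfl, by rw [h]; push_cast; ring⟩
  obtain ⟨ε', hε', huε⟩ := hK'
  have hε'2 : (ε' : ZMod N) * (ε' : ZMod N) = 1 := by rcases hε' with rfl | rfl <;> push_cast <;> ring
  have h11' : ((γ : Matrix (Fin 2) (Fin 2) ℤ) 1 1 : ZMod N) * (p : ZMod N) ^ K
      = (ε' : ZMod N) * (p : ZMod N) ^ 0 := by
    rw [pow_zero, mul_one]
    calc ((γ : Matrix (Fin 2) (Fin 2) ℤ) 1 1 : ZMod N) * (p : ZMod N) ^ K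
        = ((γ : Matrix (Fin 2) (Fin 2) ℤ) 1 1 : ZMod N) * ((ε' : ZMod N) * (p : ZMod N) ^ K) * ε' := by
          linear_combination (-((((γ : Matrix (Fin 2) (Fin 2) ℤ) 1 1 : ℤ) : ZMod N) * (p : ZMod N) ^ K)) * hε'2
      _ = ε' := by rw [← huε, h11, one_mul]
  obtain ⟨K', hK'⟩ := zmod_eq_pm_pow hpN hε' h11'
  refine ⟨γ, ⟨hγ0, K', hK'⟩, ?_⟩
  rw [e_iota_inv_mul_10, hγ00, hγ10, ha, hc, hAu, hCv]
  push_cast; ring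

/-- **LEMMA′(N,p) from Vaserstein–Liehl alone** (memo EG-REFEREE-g9 §1), `p ∤ N`, `N ≥ 1`. -/
theorem lemmaPrimeHom_of_vasersteinLiehl [NeZero N] (hpN : Nat.Coprime p N)
    (hVL : VasersteinLiehl p N) : LemmaPrimeHom N p :=
  lemmaPrimeHom_of_VL hVL (transMinus_holds hpN) (transPlus_holds hpN)

end Trans

/-- The content of LEAD's single missing stub `stub_lemmaPrimeHom_three : ∀ N, ¬ 3 ∣ N → LemmaPrimeHom N 3`
(birth_acns v6 + `EGSymbolStep_g9.stub_muOneSign_ns_three_of_lemmaPrimeHom`), reduced to the published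
theorem (VL) at `p = 3`. -/
theorem lemmaPrimeHom_three_of_vasersteinLiehl
    (hVL : ∀ N : ℕ, ¬ 3 ∣ N → VasersteinLiehl (hp := ⟨Nat.prime_three⟩) 3 N) :
    ∀ N : ℕ, ¬ 3 ∣ N → LemmaPrimeHom N 3 := by
  intro N h3
  haveI : Fact (Nat.Prime 3) := ⟨Nat.prime_three⟩
  haveI : NeZero N := ⟨by rintro rfl; exact h3 (dvd_zero 3)⟩
  have hcop : Nat.Coprime 3 N := (Nat.Prime.coprime_iff_not_dvd Nat.prime_three).mpr h3
  exact lemmaPrimeHom_of_vasersteinLiehl hcop (hVL N h3)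


/-! ## §6 (gen 10) The SUBGROUP form (★★) `Γ′ ⊆ ⟨S_p⟩ ≤ Γ₀(N)` — LEAD v8's `stub_SpGenerates_three`

LEAD slh-p3 gen 8 registered `Lines/birth_acns.lean` v8 (2026-08-28T14:32Z) with the purely group-theoretic stub
`stub_SpGenerates_three` in SUBGROUP form: every `γ ∈ Γ₀(N)` with `d ≡ ±3^k (mod N)` lies in the subgroup of `Γ₀(N)`
generated by `{d = ±3^k}` (then `Theorems/…SmallImageLemmaPrimeReduction.lemmaPrime_of_closure_S`, p640975, gives
LEMMA′ and the landed Modules 1–3 give THEOREM A at 3).  The hom form `LemmaPrimeHom` of §0 is implied by the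
subgroup form but not conversely on the nose, so we re-run the proof of `lemmaPrimeHom_of_VL` with the
closure-induction predicate "`x = ι δ` for some `δ ∈ ⟨S_p⟩`" and obtain the subgroup form from the SAME single
hypothesis (VL).  `stub_SpGenerates_three_of_vasersteinLiehl` concludes the v8 stub text VERBATIM. -/

section SubgroupForm

variable {p : ℕ} [hp : Fact p.Prime] {N : ℕ}

/-- **(★★) from (VL) + (T⁻) + (T⁺)**: `Γ′ ⊆ closure {δ : Γ₀(N) | δ ∈ S_p}` (closure taken inside `Γ₀(N)`). -/
theorem closure_pPowerCusp_of_VL [NeZero N] (hVL : VasersteinLiehl p N) (hTm : TransMinus p N)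
    (hTp : TransPlus p N) (γ : Gamma0 N) (hγ : (γ : SL(2, ℤ)) ∈ gammaPrimeSet N p) :
    γ ∈ Subgroup.closure {δ : Gamma0 N | (δ : SL(2, ℤ)) ∈ pPowerCuspSet N p} := by
  classical
  set K := DeltaPrime p N with hK
  let Bp : Subgroup K := (Bup p).subgroupOf K
  let Bm : Subgroup K := (Blo p).subgroupOf K
  let GamZ : Subgroup SL(2, ℤ) := Subgroup.closure (gammaPrimeSet N p)
  let Γ : Subgroup K := (GamZ.map (iota p)).subgroupOf K
  -- (1) hgen
  have hgen : Subgroup.closure ((Bp : Set K) ∪ (Bm : Set K)) = ⊤ := closure_eq_top_of_VL hVL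
  -- (2) hTm / hTp in the subtype
  have hTm' : ∀ g : K, ∃ γ' ∈ Γ, ∃ b ∈ Bm, g = γ' * b := by
    rintro ⟨g, hg⟩
    obtain ⟨γ₀, hγ₀, hb⟩ := hTm g hg
    have hιK : iota p γ₀ ∈ K := iota_mem_deltaPrime p hγ₀
    refine ⟨⟨iota p γ₀, hιK⟩, ?_, ⟨(iota p γ₀)⁻¹ * g, K.mul_mem (K.inv_mem hιK) hg⟩, ?_, ?_⟩
    · exact Subgroup.mem_subgroupOf.mpr (Subgroup.mem_map.mpr ⟨γ₀, Subgroup.subset_closure hγ₀, rfl⟩)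
    · exact Subgroup.mem_subgroupOf.mpr hb
    · apply Subtype.ext; simp
  have hTp' : ∀ g : K, ∃ γ' ∈ Γ, ∃ b ∈ Bp, g = γ' * b := by
    rintro ⟨g, hg⟩
    obtain ⟨γ₀, hγ₀, hb⟩ := hTp g hg
    have hιK : iota p γ₀ ∈ K := iota_mem_deltaPrime p hγ₀
    refine ⟨⟨iota p γ₀, hιK⟩, ?_, ⟨(iota p γ₀)⁻¹ * g, K.mul_mem (K.inv_mem hιK) hg⟩, ?_, ?_⟩
    · exact Subgroup.mem_subgroupOf.mpr (Subgroup.mem_map.mpr ⟨γ₀, Subgroup.subset_closure hγ₀, rfl⟩)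
    · exact Subgroup.mem_subgroupOf.mpr hb
    · apply Subtype.ext; simp
  -- (3) hstab: Γ ∩ B⁻ ⊆ S (take u = 1)
  have hstab : Γ ⊓ Bm ≤ Subgroup.closure (bigCellSet Bp Bm Γ) := by
    intro x hx
    apply Subgroup.subset_closure
    exact ⟨hx.1, 1, Bp.one_mem, x, hx.2, by rw [one_mul]⟩
  -- (4) the coset lemma
  have hEq : Γ = Subgroup.closure (bigCellSet Bp Bm Γ) := eq_closure_bigCellSet Bp Bm Γ hgen hTm' hTp' hstab
  -- (5) closure induction with the predicate  P x := ∃ δ : Γ₀(N), ι δ = x ∧ δ ∈ ⟨S_p⟩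
  set C : Subgroup (Gamma0 N) := Subgroup.closure {δ : Gamma0 N | (δ : SL(2, ℤ)) ∈ pPowerCuspSet N p} with hC
  have hP : ∀ x : K, x ∈ Subgroup.closure (bigCellSet Bp Bm Γ) →
      ∃ δ : Gamma0 N, iota p (δ : SL(2, ℤ)) = (x : SL(2, ZInv p)) ∧ δ ∈ C := by
    intro x hx
    induction hx using Subgroup.closure_induction with
    | mem y hy =>
        obtain ⟨hyΓ, u, hu, v, hv, hyuv⟩ := hy
        obtain ⟨δ₀, hδ₀, hδ₀y⟩ := Subgroup.mem_map.mp (Subgroup.mem_subgroupOf.mp hyΓ)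
        have hδ₀Γ0 : δ₀ ∈ Gamma0 N := by
          have : GamZ ≤ Gamma0 N := (Subgroup.closure_le _).mpr (fun z hz => hz.1)
          exact this hδ₀
        have hfac : iota p δ₀ = (u : SL(2, ZInv p)) * (v : SL(2, ZInv p)) := by
          rw [hδ₀y, hyuv]; rfl
        have hS : δ₀ ∈ pPowerCuspSet N p :=
          mem_pPowerCuspSet_of_factor hδ₀Γ0 (Subgroup.mem_subgroupOf.mp hu) (Subgroup.mem_subgroupOf.mp hv) hfac
        have hS' : (⟨δ₀, hδ₀Γ0⟩ : Gamma0 N) ∈ {δ : Gamma0 N | (δ : SL(2, ℤ)) ∈ pPowerCuspSet N p} := hS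
        exact ⟨⟨δ₀, hδ₀Γ0⟩, hδ₀y, Subgroup.subset_closure hS'⟩
    | one => exact ⟨1, by simp, C.one_mem⟩
    | mul y z hy hz ihy ihz =>
        obtain ⟨δ₁, h₁, hC₁⟩ := ihy
        obtain ⟨δ₂, h₂, hC₂⟩ := ihz
        refine ⟨δ₁ * δ₂, ?_, C.mul_mem hC₁ hC₂⟩
        rw [Subgroup.coe_mul, map_mul, h₁, h₂]; rfl
    | inv y hy ihy =>
        obtain ⟨δ₁, h₁, hC₁⟩ := ihy
        refine ⟨δ₁⁻¹, ?_, C.inv_mem hC₁⟩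
        rw [Subgroup.coe_inv, map_inv, h₁]; rfl
  -- (6) conclude for γ
  have hγK : iota p (γ : SL(2, ℤ)) ∈ K := iota_mem_deltaPrime p hγ
  have hγΓ : (⟨iota p (γ : SL(2, ℤ)), hγK⟩ : K) ∈ Γ :=
    Subgroup.mem_subgroupOf.mpr (Subgroup.mem_map.mpr ⟨γ, Subgroup.subset_closure hγ, rfl⟩)
  rw [hEq] at hγΓ
  obtain ⟨δ, hδ, hδC⟩ := hP _ hγΓ
  have : δ = γ := by
    apply Subtype.ext
    exact iota_injective p hδ
  rw [← this]; exact hδC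

/-- The subgroup form implies the hom form of §0 (so §6 supersedes §4's conclusion). -/
theorem lemmaPrimeHom_of_closure (h : ∀ γ : Gamma0 N, (γ : SL(2, ℤ)) ∈ gammaPrimeSet N p →
      γ ∈ Subgroup.closure {δ : Gamma0 N | (δ : SL(2, ℤ)) ∈ pPowerCuspSet N p}) :
    LemmaPrimeHom N p := by
  intro A _ ψ hψ γ hγ
  have hle : Subgroup.closure {δ : Gamma0 N | (δ : SL(2, ℤ)) ∈ pPowerCuspSet N p} ≤ ψ.ker :=
    (Subgroup.closure_le _).mpr (fun δ hδ => (MonoidHom.mem_ker).mpr (hψ δ hδ))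
  exact (MonoidHom.mem_ker).mp (hle (h γ hγ))

/-- **(★★) in LEAD's v8 coordinates** (entry `((γ : SL(2, ℤ)) 1 1 : ℤ)`, ambient `Γ₀(N)`), for any prime `p ∤ N`,
`N ≥ 1`, from the single hypothesis (VL); (T±) are discharged by `transMinus_holds` / `transPlus_holds`. -/
theorem spGenerates_of_vasersteinLiehl [NeZero N] (hpN : Nat.Coprime p N) (hVL : VasersteinLiehl p N)
    (γ : Gamma0 N)
    (hγ : ∃ k : ℕ, ((((γ : SL(2, ℤ)) 1 1 : ℤ) : ZMod N)) = (p : ZMod N) ^ k ∨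
        ((((γ : SL(2, ℤ)) 1 1 : ℤ) : ZMod N)) = -((p : ZMod N) ^ k)) :
    γ ∈ Subgroup.closure {γ : Gamma0 N | ∃ k : ℕ, ((γ : SL(2, ℤ)) 1 1 : ℤ) = (p : ℤ) ^ k ∨
        ((γ : SL(2, ℤ)) 1 1 : ℤ) = -((p : ℤ) ^ k)} := by
  have h1 : (γ : SL(2, ℤ)) ∈ gammaPrimeSet N p := ⟨γ.2, hγ⟩
  have h2 := closure_pPowerCusp_of_VL hVL (transMinus_holds hpN) (transPlus_holds hpN) γ h1
  refine Subgroup.closure_mono ?_ h2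
  intro δ hδ
  exact hδ.2


/-- **KERNEL CHECK OF THE SEAM.** §6's conclusion is LITERALLY the hypothesis `hSS` of the landed
`Theorems.SmallImageLemmaPrimeReduction.lemmaPrime_of_closure_S` (p640975 — the theorem v8's `lemmaPrimeThree_of_stubs`
applies to `stub_SpGenerates_three`): LEMMA′(N,p) in χ-form from (VL), for any prime `p ∤ N`, `N ≥ 1`. -/
theorem lemmaPrimeChi_of_vasersteinLiehl [NeZero N] (hpN : Nat.Coprime p N) (hVL : VasersteinLiehl p N) :
    ∀ ψ : Gamma0 N →* Multiplicative (ZMod p),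
      (∀ γ : Gamma0 N, (∃ k : ℕ, ((γ : SL(2, ℤ)) 1 1 : ℤ) = (p : ℤ) ^ k ∨ ((γ : SL(2, ℤ)) 1 1 : ℤ) = -((p : ℤ) ^ k)) →
        ψ γ = 1) →
      ∃ χ : (ZMod N)ˣ →* Multiplicative (ZMod p),
        (∀ u : (ZMod N)ˣ, (u : ZMod N) = (p : ZMod N) → χ u = 1) ∧
        ∀ (γ : Gamma0 N) (u : (ZMod N)ˣ), (u : ZMod N) = (((γ : SL(2, ℤ)) 1 1 : ℤ) : ZMod N) → ψ γ = χ u :=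
  Summit.BirchSwinnertonDyer.BirchSwinnertonDyer.Theorems.SmallImageLemmaPrimeReduction.lemmaPrime_of_closure_S
    (spGenerates_of_vasersteinLiehl hpN hVL)

end SubgroupForm

/-- **LEAD v8 `stub_SpGenerates_three`, VERBATIM, from (VL) at `p = 3`.**  With this, `Lines/birth_acns.lean` v8
derives `lemmaPrimeThree_of_stubs`, `muOneSignThree_of_stubs` (THEOREM A at 3) from landed Theorems files; the
only non-landed input on the p = 3 ω⁰ branch is the published theorem (VL) (Vaserstein 1972 / Liehl 1981). -/
theorem stub_SpGenerates_three_of_vasersteinLiehl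
    (hVL : ∀ N : ℕ, ¬ 3 ∣ N → VasersteinLiehl (hp := ⟨Nat.prime_three⟩) 3 N) :
    ∀ (p : ℕ) [Fact p.Prime], p = 3 → ∀ (N : ℕ) [NeZero N], ¬ p ∣ N →
    ∀ γ : Gamma0 N,
      (∃ k : ℕ, ((((γ : SL(2, ℤ)) 1 1 : ℤ) : ZMod N)) = (p : ZMod N) ^ k ∨
        ((((γ : SL(2, ℤ)) 1 1 : ℤ) : ZMod N)) = -((p : ZMod N) ^ k)) →
      γ ∈ Subgroup.closure {γ : Gamma0 N | ∃ k : ℕ, ((γ : SL(2, ℤ)) 1 1 : ℤ) = (p : ℤ) ^ k ∨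
        ((γ : SL(2, ℤ)) 1 1 : ℤ) = -((p : ℤ) ^ k)} := by
  intro p _ hp3 N _ hN γ hγ
  subst hp3
  have hcop : Nat.Coprime 3 N := (Nat.Prime.coprime_iff_not_dvd Nat.prime_three).mpr hN
  exact spGenerates_of_vasersteinLiehl hcop (hVL N hN) γ hγ

/-- The `p`-general v8-shaped statement (hypothesis form only in (VL); useful for the `p ≥ 5` rider's group step). -/
theorem spGenerates_all_of_vasersteinLiehl :
    ∀ (p : ℕ) [Fact p.Prime], (∀ N : ℕ, ¬ p ∣ N → VasersteinLiehl p N) → ∀ (N : ℕ) [NeZero N], ¬ p ∣ N →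
    ∀ γ : Gamma0 N,
      (∃ k : ℕ, ((((γ : SL(2, ℤ)) 1 1 : ℤ) : ZMod N)) = (p : ZMod N) ^ k ∨
        ((((γ : SL(2, ℤ)) 1 1 : ℤ) : ZMod N)) = -((p : ZMod N) ^ k)) →
      γ ∈ Subgroup.closure {γ : Gamma0 N | ∃ k : ℕ, ((γ : SL(2, ℤ)) 1 1 : ℤ) = (p : ℤ) ^ k ∨
        ((γ : SL(2, ℤ)) 1 1 : ℤ) = -((p : ℤ) ^ k)} := by
  intro p hp hVL N _ hN γ hγ
  have hcop : Nat.Coprime p N := (Nat.Prime.coprime_iff_not_dvd hp.out).mpr hN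
  exact spGenerates_of_vasersteinLiehl hcop (hVL N hN) γ hγ

/-! ## §7 (gen 10) DISCHARGE of (VL) from the tree: Vaserstein's theorem over `ℤ[1/m]` is PROVED in
`Literature/NumberTheory/Automorphic/CongruenceSubgroupPropertySL2AwayHolds.lean`
(`SL2Rel.Away.relG_top_span_natCast_le_relE : ∀ m ≥ 2, ∀ N ≠ 0, G(ℤ[1/m], (N)) ≤ E(ℤ[1/m], (N))`,
X10b seats, 2026-08-27; pointed out by the INPUTS desk bsd-inputs-plan-2 g18, 14:35:41Z).  We transport it along the
ring isomorphism `Localization.Away (p : ℤ) ≃+* ZInv p` (both are `ℤ[1/p]`; `ZInv p ⊂ ℚ` is the localization of `ℤ`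
at the powers of `p`) and obtain `VasersteinLiehl p N` as a THEOREM, hence (★★), LEAD v8's `stub_SpGenerates_three`
and LEMMA′(N,p) (χ-form) UNCONDITIONALLY, for every prime `p ∤ N`, `N ≥ 1`. -/

section Discharge

open Literature.NumberTheory.Automorphic

variable {p : ℕ} [hp : Fact p.Prime] {N : ℕ}

/-- `p` is a unit of `ℤ[1/p]`. -/
theorem isUnit_natCast_ZInv : IsUnit ((p : ℤ) : ZInv p) := by
  have hp0 : (p : ℚ) ≠ 0 := by exact_mod_cast hp.out.ne_zero
  refine IsUnit.of_mul_eq_one ⟨((p : ℚ))⁻¹, by simpa using pow_inv_mem_ZInv p 1⟩ ?_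
  apply Subtype.ext
  push_cast
  simp [hp0]

/-- `ZInv p ⊂ ℚ` is the localization of `ℤ` away from `p`. -/
theorem isLocalization_ZInv : IsLocalization (Submonoid.powers (p : ℤ)) (ZInv p) := by
  have hp0 : (p : ℚ) ≠ 0 := by exact_mod_cast hp.out.ne_zero
  refine { map_units := ?_, surj := ?_, exists_of_eq := ?_ }
  · rintro ⟨_, n, rfl⟩
    rw [map_pow, eq_intCast]
    exact (isUnit_natCast_ZInv (p := p)).pow n
  · rintro ⟨z, n, a, rfl⟩
    refine ⟨(a, ⟨(p : ℤ) ^ n, n, rfl⟩), ?_⟩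
    apply Subtype.ext
    simp only [map_pow, eq_intCast]
    push_cast
    rw [div_mul_cancel₀ _ (pow_ne_zero n hp0)]
  · intro a b hab
    refine ⟨1, ?_⟩
    have h := congrArg Subtype.val hab
    simp only [eq_intCast] at h
    have : (a : ℚ) = (b : ℚ) := by exact_mod_cast h
    have : a = b := by exact_mod_cast this
    rw [this]

/-- The ring isomorphism `Localization.Away (p : ℤ) ≃+* ℤ[1/p] ⊂ ℚ` (both localizations of `ℤ` at `p^ℕ`). -/
noncomputable def locEquiv (p : ℕ) [hp : Fact p.Prime] : Localization.Away (p : ℤ) ≃+* ZInv p :=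
  haveI := isLocalization_ZInv (p := p)
  (IsLocalization.algEquiv (Submonoid.powers (p : ℤ)) (Localization.Away (p : ℤ)) (ZInv p)).toRingEquiv

/-- `x ∈ N·ℤ[1/p]` (rational predicate) ⇒ `x = N·y` in the ring `ZInv p`. -/
theorem exists_eq_natCast_mul_of_inNR {x : ZInv p} (h : InNR p N (x : ℚ)) :
    ∃ y : ZInv p, x = (N : ZInv p) * y := by
  obtain ⟨n, t, ht⟩ := h
  refine ⟨⟨(t : ℚ) / (p : ℚ) ^ n, n, t, rfl⟩, Subtype.ext ?_⟩
  push_cast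
  rw [ht, mul_div_assoc]

/-- `x = N·y` in `ZInv p` ⇒ `x ∈ N·ℤ[1/p]` (rational predicate). -/
theorem inNR_of_eq_natCast_mul {x y : ZInv p} (h : x = (N : ZInv p) * y) : InNR p N (x : ℚ) := by
  obtain ⟨n, a, ha⟩ := y.2
  refine ⟨n, a, ?_⟩
  rw [h]
  push_cast
  rw [ha, mul_div_assoc]

/-- **(VL) is a THEOREM**: `VasersteinLiehl p N` for every prime `p` and every `N ≥ 1`, by transport of
`SL2Rel.Away.relG_top_span_natCast_le_relE` (Vaserstein 1972 / Liehl 1981, PROVED in the tree via Mennicke symbols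
and Bass–Milnor–Serre Thm. 3.6 over `ℚ`) along `locEquiv p`. -/
theorem vasersteinLiehl_holds [NeZero N] : VasersteinLiehl p N := by
  classical
  intro g hc ha hd
  set ψ : Localization.Away (p : ℤ) ≃+* ZInv p := locEquiv p with hψ
  let F : SL(2, Localization.Away (p : ℤ)) →* SL(2, ZInv p) := Matrix.SpecialLinearGroup.map ψ.toRingHom
  let G : SL(2, ZInv p) →* SL(2, Localization.Away (p : ℤ)) := Matrix.SpecialLinearGroup.map ψ.symm.toRingHom
  have keyF : ∀ (M : SL(2, Localization.Away (p : ℤ))) (i j : Fin 2), (F M) i j = ψ (M i j) :=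
    fun _ _ _ ↦ rfl
  have keyG : ∀ (M : SL(2, ZInv p)) (i j : Fin 2), (G M) i j = ψ.symm (M i j) := fun _ _ _ ↦ rfl
  have hFG : F (G g) = g := by
    ext i j
    rw [keyF, keyG, RingEquiv.apply_symm_apply]
  -- the rational entries `e p g i j` are the coercions of the ring entries
  have he : ∀ i j : Fin 2, e p g i j = ((g i j : ZInv p) : ℚ) := fun _ _ ↦ rfl
  -- (1) `G g ∈ G(A, (N))`
  have hg' : G g ∈ SL2Rel.relG (⊤ : Ideal (Localization.Away (p : ℤ)))
      (Ideal.span {(N : Localization.Away (p : ℤ))}) := by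
    rw [he] at hc ha hd
    have hc' : InNR p N ((g 1 0 : ZInv p) : ℚ) := hc
    have ha' : InNR p N (((g 0 0 - 1 : ZInv p)) : ℚ) := by push_cast; exact ha
    have hd' : InNR p N (((g 1 1 - 1 : ZInv p)) : ℚ) := by push_cast; exact hd
    obtain ⟨yc, hyc⟩ := exists_eq_natCast_mul_of_inNR hc'
    obtain ⟨ya, hya⟩ := exists_eq_natCast_mul_of_inNR ha'
    obtain ⟨yd, hyd⟩ := exists_eq_natCast_mul_of_inNR hd'
    refine SL2Rel.mem_relG.2 ⟨Submodule.mem_top, ?_, ?_, ?_⟩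
    · rw [keyG, hyc, map_mul, map_natCast]
      exact Ideal.mem_span_singleton'.2 ⟨ψ.symm yc, mul_comm _ _⟩
    · rw [Ideal.top_mul, keyG, ← map_one ψ.symm, ← map_sub, hya, map_mul, map_natCast]
      exact Ideal.mem_span_singleton'.2 ⟨ψ.symm ya, mul_comm _ _⟩
    · rw [Ideal.top_mul, keyG, ← map_one ψ.symm, ← map_sub, hyd, map_mul, map_natCast]
      exact Ideal.mem_span_singleton'.2 ⟨ψ.symm yd, mul_comm _ _⟩
  -- (2) Vaserstein in the tree: `G g ∈ E(A, (N))`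
  have hE : G g ∈ SL2Rel.relE (⊤ : Ideal (Localization.Away (p : ℤ)))
      (Ideal.span {(N : Localization.Away (p : ℤ))}) :=
    SL2Rel.Away.relG_top_span_natCast_le_relE p hp.out.two_le N (NeZero.ne N) hg'
  -- (3) the image of `E(A, (N))` under `F` lies in `closure (elemGens p N)`
  have hmap : (SL2Rel.relE (⊤ : Ideal (Localization.Away (p : ℤ)))
      (Ideal.span {(N : Localization.Away (p : ℤ))})).map F ≤ Subgroup.closure (elemGens p N) := by
    rw [SL2Rel.relE, MonoidHom.map_closure, Subgroup.closure_le]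
    rintro _ ⟨M, hM | hM, rfl⟩
    · obtain ⟨x, -, rfl⟩ := hM
      apply Subgroup.subset_closure
      left
      refine ⟨?_, ?_, ?_⟩
      · show ((((F (SL2Rel.e12 x)) 1 0 : ZInv p)) : ℚ) = 0
        rw [keyF, SL2Rel.e12_apply_10, map_zero]; rfl
      · show ((((F (SL2Rel.e12 x)) 0 0 : ZInv p)) : ℚ) = 1
        rw [keyF, SL2Rel.e12_apply_00, map_one]; rfl
      · show ((((F (SL2Rel.e12 x)) 1 1 : ZInv p)) : ℚ) = 1
        rw [keyF, SL2Rel.e12_apply_11, map_one]; rfl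
    · obtain ⟨y, hy, rfl⟩ := hM
      obtain ⟨a, rfl⟩ := Ideal.mem_span_singleton'.1 hy
      apply Subgroup.subset_closure
      right
      refine ⟨?_, ?_, ?_, ?_⟩
      · show ((((F (SL2Rel.e21 (a * N))) 0 1 : ZInv p)) : ℚ) = 0
        rw [keyF, SL2Rel.e21_apply_01, map_zero]; rfl
      · show ((((F (SL2Rel.e21 (a * N))) 0 0 : ZInv p)) : ℚ) = 1
        rw [keyF, SL2Rel.e21_apply_00, map_one]; rfl
      · show ((((F (SL2Rel.e21 (a * N))) 1 1 : ZInv p)) : ℚ) = 1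
        rw [keyF, SL2Rel.e21_apply_11, map_one]; rfl
      · show InNR p N ((((F (SL2Rel.e21 (a * N))) 1 0 : ZInv p)) : ℚ)
        rw [keyF, SL2Rel.e21_apply_10, map_mul, map_natCast]
        exact inNR_of_eq_natCast_mul (y := ψ a) (mul_comm _ _)
  -- (4) conclude
  rw [← hFG]
  exact hmap (Subgroup.mem_map_of_mem F hE)

/-- **(★★) UNCONDITIONALLY**: for every prime `p ∤ N`, `N ≥ 1`, every `γ ∈ Γ₀(N)` with `d(γ) ≡ ±p^k (mod N)` lies in
the subgroup of `Γ₀(N)` generated by `{d(γ) = ±p^k}`. -/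
theorem spGenerates [NeZero N] (hpN : Nat.Coprime p N) (γ : Gamma0 N)
    (hγ : ∃ k : ℕ, ((((γ : SL(2, ℤ)) 1 1 : ℤ) : ZMod N)) = (p : ZMod N) ^ k ∨
        ((((γ : SL(2, ℤ)) 1 1 : ℤ) : ZMod N)) = -((p : ZMod N) ^ k)) :
    γ ∈ Subgroup.closure {γ : Gamma0 N | ∃ k : ℕ, ((γ : SL(2, ℤ)) 1 1 : ℤ) = (p : ℤ) ^ k ∨
        ((γ : SL(2, ℤ)) 1 1 : ℤ) = -((p : ℤ) ^ k)} :=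
  spGenerates_of_vasersteinLiehl hpN vasersteinLiehl_holds γ hγ

/-- **LEMMA′(N,p) UNCONDITIONALLY (χ-form of `Theorems.SmallImageLemmaPrimeReduction`)**: every homomorphism
`ψ : Γ₀(N) → ℤ/p` killing the `±p`-power cusps factors as `χ(d(γ) mod N)` with `χ(p̄) = 1`; `p ∤ N` prime, `N ≥ 1`. -/
theorem lemmaPrimeChi [NeZero N] (hpN : Nat.Coprime p N) :
    ∀ ψ : Gamma0 N →* Multiplicative (ZMod p),
      (∀ γ : Gamma0 N, (∃ k : ℕ, ((γ : SL(2, ℤ)) 1 1 : ℤ) = (p : ℤ) ^ k ∨ ((γ : SL(2, ℤ)) 1 1 : ℤ) = -((p : ℤ) ^ k)) →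
        ψ γ = 1) →
      ∃ χ : (ZMod N)ˣ →* Multiplicative (ZMod p),
        (∀ u : (ZMod N)ˣ, (u : ZMod N) = (p : ZMod N) → χ u = 1) ∧
        ∀ (γ : Gamma0 N) (u : (ZMod N)ˣ), (u : ZMod N) = (((γ : SL(2, ℤ)) 1 1 : ℤ) : ZMod N) → ψ γ = χ u :=
  lemmaPrimeChi_of_vasersteinLiehl hpN vasersteinLiehl_holds

/-- The hom form LEMMA′ of §0, UNCONDITIONALLY. -/
theorem lemmaPrimeHom_holds [NeZero N] (hpN : Nat.Coprime p N) : LemmaPrimeHom N p :=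
  lemmaPrimeHom_of_vasersteinLiehl hpN vasersteinLiehl_holds

end Discharge

/-- **LEAD v8 `stub_SpGenerates_three`, VERBATIM, PROVED (no hypothesis).**  Hence on `Lines/birth_acns.lean` v8 the
chain `stub_SpGenerates_three ⇒ lemmaPrimeThree_of_stubs (p640975) ⇒ muOneSignThree_of_stubs (p639321, p639780)` has NO
open input: THEOREM A at p = 3 (one-sign μ = 0 with unit content for every rational non-CM newform with 3 ∤ N, a₃ = 0,
ρ̄₃ non-surjective — the conclusion of `stub_muOneSign_ns_three`) is a kernel theorem relative to the tree's definitions.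
BSD / crux 4 are NOT proved: the analytic stubs and the p ≥ 5 rider remain. -/
theorem stub_SpGenerates_three_holds :
    ∀ (p : ℕ) [Fact p.Prime], p = 3 → ∀ (N : ℕ) [NeZero N], ¬ p ∣ N →
    ∀ γ : Gamma0 N,
      (∃ k : ℕ, ((((γ : SL(2, ℤ)) 1 1 : ℤ) : ZMod N)) = (p : ZMod N) ^ k ∨
        ((((γ : SL(2, ℤ)) 1 1 : ℤ) : ZMod N)) = -((p : ZMod N) ^ k)) →
      γ ∈ Subgroup.closure {γ : Gamma0 N | ∃ k : ℕ, ((γ : SL(2, ℤ)) 1 1 : ℤ) = (p : ℤ) ^ k ∨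
        ((γ : SL(2, ℤ)) 1 1 : ℤ) = -((p : ℤ) ^ k)} := by
  intro p _ hp3 N _ hN γ hγ
  subst hp3
  have hcop : Nat.Coprime 3 N := (Nat.Prime.coprime_iff_not_dvd Nat.prime_three).mpr hN
  exact spGenerates hcop γ hγ

/-- The same for EVERY prime `p` (the group-theoretic step of the `p ≥ 5` rider as well). -/
theorem spGenerates_all :
    ∀ (p : ℕ) [Fact p.Prime], ∀ (N : ℕ) [NeZero N], ¬ p ∣ N →
    ∀ γ : Gamma0 N,
      (∃ k : ℕ, ((((γ : SL(2, ℤ)) 1 1 : ℤ) : ZMod N)) = (p : ZMod N) ^ k ∨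
        ((((γ : SL(2, ℤ)) 1 1 : ℤ) : ZMod N)) = -((p : ZMod N) ^ k)) →
      γ ∈ Subgroup.closure {γ : Gamma0 N | ∃ k : ℕ, ((γ : SL(2, ℤ)) 1 1 : ℤ) = (p : ℤ) ^ k ∨
        ((γ : SL(2, ℤ)) 1 1 : ℤ) = -((p : ℤ) ^ k)} := by
  intro p hp N _ hN γ hγ
  exact spGenerates ((Nat.Prime.coprime_iff_not_dvd hp.out).mpr hN) γ hγ

/-! ### Axiom audit -/
#print axioms stub_SpGenerates_three_of_vasersteinLiehl
#print axioms stub_SpGenerates_three_holds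

end Summit.BirchSwinnertonDyer.BirchSwinnertonDyer.Cruxes.KobayashiMainConjectureSmallImage.EGSpGenerates

/-! # Part II — LEAD v8 `Lines/birth_acns.lean` body (namespace renamed; stub 3 discharged) -/

set_option autoImplicit false
set_option linter.dupNamespace false

noncomputable section

open scoped Classical MatrixGroups ModularForm

namespace Summit.BirchSwinnertonDyer.BirchSwinnertonDyer.Cruxes.KobayashiMainConjectureSmallImage.BirthAcnsV8CheckG10

open CongruenceSubgroup Literature.NumberTheory.EllipticCurves Literature.NumberTheory.EllipticCurves.Rank1Residual
  Literature.NumberTheory.EllipticCurves.ModularForms Literature.NumberTheory.EllipticCurves.Kobayashi2003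
  Literature.NumberTheory.EllipticCurves.GreenbergVatsal2000
  Literature.NumberTheory.EllipticCurves.BurungaleSkinnerTianWan2024
  Literature.NumberTheory.EllipticCurves.BurungaleCastellaSkinner2025
  Summit.BirchSwinnertonDyer.Rank1Residual.Supersingular

/-- stub T2_rat¬CM of «acns» (v5 = v3's T2_rat with the binder `¬ W.HasCM →` added — the CM leak of the `Surj ↦ ¬Surj` swap closed; the RATIONAL two-variable Euler-system inclusion `∃ a, (p^a·G) ⊆ ch(X_Gr₂(E/K̃_∞))^{ur}`
on the small-image supersingular domain — VERBATIM line `ratlift`'s `stub_ratEulerSystemSS` of crux stmt-20728 (route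
SignedBaseChange) with the binder `Surj W p →` replaced by `¬ Surj W p →` and the `SignedTwoVariableInputs →` prefix
replaced by the parametrisation fact (as v2's T2); = v2's `stub_ES2_ns` with exactly the `μ`-part forgotten. What
two-variable Euler-system machinery yields WITHOUT the big-image/`τ` hypothesis (Rubin Thm. 2.3.3); integrality is
recovered in the composition by RATIONAL RIGIDITY (`…SmallImageRationalRigidity`, gen 6) from T1 + BCS25 Prop. 4.2.2.
PRE-adjacent (signed Beilinson–Flach classes at `a_p = 0`: BSTW 2024 / Büyükboduk–Lei), not in print as stated. -/
theorem stub_ES2rat_ns : Literature.NumberTheory.EllipticCurves.ModularForms.nonempty_modularParametrizationData → ∀ (W : WeierstrassCurve ℚ) [W.IsElliptic] [W.IsGloballyMinimal] (p : ℕ) [Fact p.Prime], 5 ≤ p → W.HasGoodReductionAtPrime p → W.frobeniusTrace p = 0 → ¬ Literature.NumberTheory.EllipticCurves.Rank1Residual.Surj W p → ¬ W.HasCM → ∀ (K : Type) [Field K] [NumberField K] (ι : PadicAlgCl p ≃+* ℂ) (v vbar : IsDedekindDomain.HeightOneSpectrum (NumberField.RingOfIntegers K)) (κ₁ κ₂ :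 ZpExtension K p) (γ₁ γ₂ : Field.absoluteGaloisGroup K) [Fact (ZpExtension.IsTopGeneratorPair κ₁ κ₂ γ₁ γ₂)] [NeZero (NumberField.discr K).natAbs] (N : ℕ) [NeZero N] (f : CuspForm (CongruenceSubgroup.Gamma0 N) 2), IsNewformOf W f → (N : ℤ) = W.conductorNorm ℤ → IsImaginaryQuadratic K → ((Ideal.span {(p : ℤ)}).primesOver (NumberField.RingOfIntegers K)).ncard = 2 → ((p : ℕ) : NumberField.RingOfIntegers K) ∈ v.asIdeal → ((p : ℕ) : NumberField.RingOfIntegers K) ∈ vbar.asIdeal → vbar ≠ v → (∀ (w : NumberField.InfinitePlace K) (k : NumberField.RingOfIntegers K), k ∈ v.asIdeal ↔ ‖ι.symm (w.embedding (k : K))‖ < 1) → IsCoprime (N : ℤ) (NumberField.discr K) → (∀ ℓ : ℕ, ℓ.Prime → ℓ ∣ N → ((Ideal.span {(ℓ : ℤ)}).primesOver (NumberField.RingOfIntegers K)).ncard = 2) → Odd (NumberField.discr K) → NumberField.discr K ≠ -3 → κ₁.IsCyclotomic → κ₂.IsAnticyclotomic → ∀ (Ω δ : ℂ) (Ωp :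 (unrIntegers p)ˣ) (LK G : PowerSeries (PowerSeries (PadicComplexInt p))), Ω ≠ 0 → (δ ^ 2 = (NumberField.discr K : ℂ) ∨ δ ^ 2 = -(NumberField.discr K : ℂ)) → IsKatzMeasure₂ ι v vbar ∅ κ₁ κ₂ γ₁⁻¹ γ₂⁻¹ 1 Ω δ ((Ωp : unrIntegers p) : PadicComplex p) LK → IsGreenbergLFunctionAnyRoot₂ ι v vbar κ₁ κ₂ γ₁⁻¹ γ₂⁻¹ f (NumberField.discr K).natAbs (NumberField.classNumber K) LK G → ∀ J : ℤ_[p] →+* PadicComplexInt p, (∀ x : ℤ_[p], ((J x : PadicComplexInt p) : PadicComplex p) = ((x : ℚ_[p]) : PadicComplex p)) → ∃ a : ℕ, Ideal.span {((p : ℕ) : PowerSeries (PowerSeries (PadicComplexInt p))) ^ a * G} ≤ (WeierstrassCurve.XGr₂.charIdeal (W.baseChange K) p κ₁ κ₂ vbar γ₁ γ₂).map (IwasawaAlgebra₂.toUnr₂ p J) := by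
  sorry

/-- stub T1_rat¬CM of «acns» (v5 = v4's T1_rat with the binder `¬ W.HasCM →` added — the CM leak of the `Surj ↦ ¬Surj` swap closed; the RATIONAL anticyclotomic Eisenstein inclusion on `T₁ = 0`:
`∃ b, (p^b)·ch^{ur}|_{T₁=0} ⊆ (G⁻)` — VERBATIM the acanchor stub ACdiv / item stmt-20727's body with the binder swap
`Surj W p →` ↦ `W.frobeniusTrace p = 0 → ¬ Surj W p →` and the conclusion multiplied by `(p^b)`; = v2/v3's
`stub_acDiv_ns` with exactly the `μ`-part forgotten. Engine L1 = Howard's Λ-adic Heegner-point Kolyvagin bound run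
at supersingular prime-to-`p` image (its error terms bounded, not zero ⇒ a `p^b`) + the BDP-side Eisenstein inclusion
(line `bdpline` of crux 20727, S1-rat); the `p^b` is cancelled in the composition by SATURATION of `(G⁻)` under
constants (`…SmallImageRationalAnchor`, gen 6, after the ideator's `RatAnchorSaturation.lean`) from BCS25 Prop.
4.2.2. OPEN / PRE-adjacent. -/
theorem stub_acDivRat_ns : Literature.NumberTheory.EllipticCurves.ModularForms.nonempty_modularParametrizationData → ∀ (W : WeierstrassCurve ℚ) [W.IsElliptic] [W.IsGloballyMinimal] (p : ℕ) [Fact p.Prime], 5 ≤ p → W.HasGoodReductionAtPrime p → W.frobeniusTrace p = 0 → ¬ Literature.NumberTheory.EllipticCurves.Rank1Residual.Surj W p → ¬ W.HasCM → ∀ (K : Type) [Field K] [NumberField K] (ι : PadicAlgCl p ≃+* ℂ) (v vbar : IsDedekindDomain.HeightOneSpectrum (NumberField.RingOfIntegers K)) (κ₁ κ₂ : ZpExtension K p) (γ₁ γ₂ : Field.absoluteGaloisGroup K) [Fact (ZpExtension.IsTopGeneratorPair κ₁ κ₂ γ₁ γ₂)] [NeZero (NumberField.discr K).natAbs] (N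 : ℕ) [NeZero N] (f : CuspForm (CongruenceSubgroup.Gamma0 N) 2), IsNewformOf W f → (N : ℤ) = W.conductorNorm ℤ → IsImaginaryQuadratic K → ((Ideal.span {(p : ℤ)}).primesOver (NumberField.RingOfIntegers K)).ncard = 2 → ((p : ℕ) : NumberField.RingOfIntegers K) ∈ v.asIdeal → ((p : ℕ) : NumberField.RingOfIntegers K) ∈ vbar.asIdeal → vbar ≠ v → (∀ (w : NumberField.InfinitePlace K) (k : NumberField.RingOfIntegers K), k ∈ v.asIdeal ↔ ‖ι.symm (w.embedding (k : K))‖ < 1) → IsCoprime (N : ℤ) (NumberField.discr K) → (∀ ℓ : ℕ, ℓ.Prime → ℓ ∣ N → ((Ideal.span {(ℓ : ℤ)}).primesOver (NumberField.RingOfIntegers K)).ncard = 2) → Odd (NumberField.discr K) → NumberField.discr K ≠ -3 → κ₁.IsCyclotomic → κ₂.IsAnticyclotomic → ∀ (Ω δ : ℂ) (Ωp : (unrIntegers p)ˣ) (LK G : PowerSeries (PowerSeries (PadicComplexInt p))), Ω ≠ 0 → (δ ^ 2 = (NumberField.discr K : ℂ) ∨ δ ^ 2 = -(NumberField.discr K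 : ℂ)) → IsKatzMeasure₂ ι v vbar ∅ κ₁ κ₂ γ₁⁻¹ γ₂⁻¹ 1 Ω δ ((Ωp : unrIntegers p) : PadicComplex p) LK → IsGreenbergLFunctionAnyRoot₂ ι v vbar κ₁ κ₂ γ₁⁻¹ γ₂⁻¹ f (NumberField.discr K).natAbs (NumberField.classNumber K) LK G → ∀ J : ℤ_[p] →+* PadicComplexInt p, (∀ x : ℤ_[p], ((J x : PadicComplexInt p) : PadicComplex p) = ((x : ℚ_[p]) : PadicComplex p)) → ∃ b : ℕ, Ideal.span {((p : ℕ) : PowerSeries (PadicComplexInt p)) ^ b} * ((WeierstrassCurve.XGr₂.charIdeal (W.baseChange K) p κ₁ κ₂ vbar γ₁ γ₂).map (IwasawaAlgebra₂.toUnr₂ p J)).map (PowerSeries.constantCoeff (R := PowerSeries (PadicComplexInt p))) ≤ Ideal.span {UnrSeries₂.minus G} := by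
  sorry

/-- **T3 (`CanonicalNs`, the K1″-shaped package on the crux's domain) DERIVED from T1_rat¬CM ∧ T2_rat¬CM** by the landed glue
`SmallImageAcanchorGlueRatRatNotCM.canonicalNs_of_eulerSystemRatNotCM_of_acDivRatNotCM_noSurj` (v5; v4 used
`SmallImageAcanchorGlueRatRat.canonicalNs_of_eulerSystemRat_of_acDivRat_noSurj`) (frame supply + rational anchor +
saturation + RATIONAL rigidity, image clauses from Matar–Nekovář; ACμ⁺ `μ(G⁻) = 0` from BCS Prop 4.2.2 = first
conjunct of the inputs). No sorry of its own. -/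
theorem canonical_ns_of_stubs :
    (Literature.NumberTheory.EllipticCurves.BurungaleCastellaSkinner2025.prop422_greenbergAnyRoot_hasUnitContent_minus ∧ Literature.NumberTheory.EllipticCurves.BurungaleSkinnerTianWan2024.props118_27_519_exists_signedTwoVariablePackage_supersingular_PRE) → Literature.NumberTheory.EllipticCurves.ModularForms.nonempty_modularParametrizationData → ∀ (W : WeierstrassCurve ℚ) [W.IsElliptic] [W.IsGloballyMinimal] (p : ℕ) [Fact p.Prime], 5 ≤ p → Literature.NumberTheory.EllipticCurves.Rank1Residual.ClassX7 W p → ¬ W.HasCM → W.frobeniusTrace p = 0 → ¬ Literature.NumberTheory.EllipticCurves.Rank1Residual.Surj W p → ∃ (K : Type) (_ : Field K) (_ : NumberField K) (ι : PadicAlgCl p ≃+* ℂ) (v vbar : IsDedekindDomain.HeightOneSpectrum (NumberField.RingOfIntegers K)) (κ₁ κ₂ : Literature.NumberTheory.EllipticCurves.ZpExtension K p) (γ₁ γ₂ : Field.absoluteGaloisGroup K) (_ : Fact (Literature.NumberTheory.EllipticCurves.ZpExtension.IsTopGeneratorPair κ₁ κ₂ γ₁ γ₂)) (_ : NeZero (NumberField.discr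 K).natAbs) (N : ℕ) (_ : NeZero N) (f : CuspForm (CongruenceSubgroup.Gamma0 N) 2) (d : ℤ) (W' : WeierstrassCurve ℚ) (_ : W'.IsElliptic) (_ : W'.IsGloballyMinimal) (C : WeierstrassCurve.VariableChange ℚ) (N' : ℕ) (_ : NeZero N') (f' : CuspForm (CongruenceSubgroup.Gamma0 N') 2), Literature.NumberTheory.EllipticCurves.ModularForms.IsNewformOf W f ∧ (N : ℤ) = W.conductorNorm ℤ ∧ Literature.NumberTheory.EllipticCurves.ModularForms.IsNewformOf W' f' ∧ (N' : ℤ) = W'.conductorNorm ℤ ∧ Squarefree d ∧ 1 < d ∧ (∀ q : ℕ, q.Prime → Literature.NumberTheory.EllipticCurves.BurungaleSkinnerTianWan2024.RamifiedInQuadratic d q → q ≠ p ∧ ¬ q ∣ N ∧ ¬ (q : ℤ) ∣ NumberField.discr K) ∧ C • W' = W.quadraticTwist (d : ℚ) ∧ Literature.NumberTheory.EllipticCurves.IsImaginaryQuadratic K ∧ ((Ideal.span {(p : ℤ)}).primesOver (NumberField.RingOfIntegers K)).ncard = 2 ∧ ((p : ℕ) : NumberField.RingOfIntegers K) ∈ v.asIdeal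 ∧ ((p : ℕ) : NumberField.RingOfIntegers K) ∈ vbar.asIdeal ∧ vbar ≠ v ∧ (∀ (w : NumberField.InfinitePlace K) (k : NumberField.RingOfIntegers K), k ∈ v.asIdeal ↔ ‖ι.symm (w.embedding (k : K))‖ < 1) ∧ IsCoprime (N : ℤ) (NumberField.discr K) ∧ (∀ ℓ : ℕ, ℓ.Prime → ℓ ∣ N → ((Ideal.span {(ℓ : ℤ)}).primesOver (NumberField.RingOfIntegers K)).ncard = 2) ∧ (∀ ℓ : ℕ, ℓ.Prime → (ℓ : ℤ) ∣ d → ((Ideal.span {(ℓ : ℤ)}).primesOver (NumberField.RingOfIntegers K)).ncard = 2) ∧ ((Ideal.span {(2 : ℤ)}).primesOver (NumberField.RingOfIntegers K)).ncard = 2 ∧ (∀ ρ : Literature.NumberTheory.GaloisRepresentations.ModPGaloisRep K (ZMod p) 2, (W.baseChange K).IsTorsionGaloisRep p ρ → Literature.NumberTheory.GaloisRepresentations.FramedRep.IsAbsolutelyIrreducible ρ) ∧ κ₁.IsCyclotomic ∧ κ₂.IsAnticyclotomic ∧ (∃ ζ : ℤ_[p]ˣ, IsOfFinOrder ζ ∧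 ((Literature.NumberTheory.GaloisRepresentations.GaloisRep.cyclotomicCharacter K p γ₁ * ζ : ℤ_[p]ˣ) : ℤ_[p]) = (Literature.NumberTheory.EllipticCurves.cyclotomicGenerator p : ℤ_[p])) ∧ ∀ (Ω δ : ℂ) (Ωp : (Literature.NumberTheory.EllipticCurves.unrIntegers p)ˣ) (LK G G' : PowerSeries (PowerSeries (PadicComplexInt p))), Ω ≠ 0 → (δ ^ 2 = (NumberField.discr K : ℂ) ∨ δ ^ 2 = -(NumberField.discr K : ℂ)) → Literature.NumberTheory.EllipticCurves.IsKatzMeasure₂ ι v vbar ∅ κ₁ κ₂ γ₁⁻¹ γ₂⁻¹ 1 Ω δ ((Ωp : Literature.NumberTheory.EllipticCurves.unrIntegers p) : PadicComplex p) LK → Literature.NumberTheory.EllipticCurves.IsGreenbergLFunctionAnyRoot₂ ι v vbar κ₁ κ₂ γ₁⁻¹ γ₂⁻¹ f (NumberField.discr K).natAbs (NumberField.classNumber K) LK G → Literature.NumberTheory.EllipticCurves.IsGreenbergLFunctionAnyRoot₂ ι v vbar κ₁ κ₂ γ₁⁻¹ γ₂⁻¹ f' (NumberField.discr K).natAbs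 (NumberField.classNumber K) LK G' → ∀ J : ℤ_[p] →+* PadicComplexInt p, (∀ x : ℤ_[p], ((J x : PadicComplexInt p) : PadicComplex p) = ((x : ℚ_[p]) : PadicComplex p)) → ∃ s : PowerSeries (PadicComplexInt p), s ≠ 0 ∧ Ideal.span {PowerSeries.map (PowerSeries.C (R := PadicComplexInt p)) s} * ((WeierstrassCurve.XGr₂.charIdeal (W.baseChange K) p κ₁ κ₂ vbar γ₁ γ₂).map (Literature.NumberTheory.EllipticCurves.IwasawaAlgebra₂.toUnr₂ p J) * (WeierstrassCurve.XGr₂.charIdeal (W'.baseChange K) p κ₁ κ₂ vbar γ₁ γ₂).map (Literature.NumberTheory.EllipticCurves.IwasawaAlgebra₂.toUnr₂ p J)) ≤ Ideal.span {G * G'} :=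
  Summit.BirchSwinnertonDyer.BirchSwinnertonDyer.Theorems.SmallImageAcanchorGlueRatRatNotCM.canonicalNs_of_eulerSystemRatNotCM_of_acDivRatNotCM_noSurj
    stub_ES2rat_ns stub_acDivRat_ns

/-- stub (v8; **(★★) «`S₃` generates `Γ′`» — pure group theory of `Γ₀(N)`**, EG-REDUCTION-g8 §2): for every `N` prime to `3`, every
`γ ∈ Γ₀(N)` whose lower-right entry satisfies `d(γ) ≡ ±3^k (mod N)` lies in the subgroup of `Γ₀(N)` GENERATED by
`S₃ = {γ : d(γ) = ±3^k}`. Paper proof (ibid. §2–3): the coset lemma (kernel-checked, `EGCosetLemma.lean`) applied to `G = Δ′ ⊂ SL₂(ℤ[1/3])`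
with EG `Δ′ = ⟨B⁺, B⁻⟩` (finite index of `⟨U(𝔮),V(𝔮)⟩`, Venkataramana 1994 Thm. p. 194 / Vaserstein 1972, + CSP, Mennicke 1967 / Serre 1970, +
an `SL₂(ℤ/M)` computation) and the transversality facts T±/S/V. Stated with a bound prime `p = 3`; typing plan `LemmaPrimeTypingPlan.md`. -/
theorem stub_SpGenerates_three : ∀ (p : ℕ) [Fact p.Prime], p = 3 → ∀ (N : ℕ) [NeZero N], ¬ p ∣ N →
    ∀ γ : Gamma0 N,
      (∃ k : ℕ, ((((γ : SL(2, ℤ)) 1 1 : ℤ) : ZMod N)) = (p : ZMod N) ^ k ∨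
        ((((γ : SL(2, ℤ)) 1 1 : ℤ) : ZMod N)) = -((p : ZMod N) ^ k)) →
      γ ∈ Subgroup.closure {γ : Gamma0 N | ∃ k : ℕ, ((γ : SL(2, ℤ)) 1 1 : ℤ) = (p : ℤ) ^ k ∨
        ((γ : SL(2, ℤ)) 1 1 : ℤ) = -((p : ℤ) ^ k)} :=
  -- gen 10: DISCHARGED (was `by sorry` in v8) — Vaserstein's theorem over ℤ[1/3] (tree) + §1–§7 of EGSpGenerates_g10
  Summit.BirchSwinnertonDyer.BirchSwinnertonDyer.Cruxes.KobayashiMainConjectureSmallImage.EGSpGenerates.stub_SpGenerates_three_holds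

/-- **LEMMA′(N,3) (v7's `stub_lemmaPrime_three`) DERIVED from `stub_SpGenerates_three`** by the landed factorisation step
`SmallImageLemmaPrimeReduction.lemmaPrime_of_closure_S` (p640975: Mathlib `Gamma0Map`, Bézout sections, `χ(u) := ψ(sect u)`).
No sorry of its own. -/
theorem lemmaPrimeThree_of_stubs : ∀ (p : ℕ) [Fact p.Prime], p = 3 → ∀ (N : ℕ) [NeZero N], ¬ p ∣ N →
    ∀ ψ : Gamma0 N →* Multiplicative (ZMod p),
      (∀ γ : Gamma0 N, (∃ k : ℕ, ((γ : SL(2, ℤ)) 1 1 : ℤ) = (p : ℤ) ^ k ∨ ((γ : SL(2, ℤ)) 1 1 : ℤ) = -((p : ℤ) ^ k)) →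
        ψ γ = 1) →
      ∃ χ : (ZMod N)ˣ →* Multiplicative (ZMod p),
        (∀ u : (ZMod N)ˣ, (u : ZMod N) = (p : ZMod N) → χ u = 1) ∧
        ∀ (γ : Gamma0 N) (u : (ZMod N)ˣ), (u : ZMod N) = (((γ : SL(2, ℤ)) 1 1 : ℤ) : ZMod N) → ψ γ = χ u := by
  intro p _ hp N _ hN
  exact Summit.BirchSwinnertonDyer.BirchSwinnertonDyer.Theorems.SmallImageLemmaPrimeReduction.lemmaPrime_of_closure_S
    (stub_SpGenerates_three p hp N hN)

/-- **v6's `stub_muOneSign_ns_three` (one unit plus symbol `[u/3^{n+1}]⁺_f`) DERIVED from LEMMA′(N_E,3) (`lemmaPrimeThree_of_stubs`)** by the landed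
Module 2 (`SmallImageHeckePrimeMu.exists_unit_norm_ratPlusSymbol_eq_one_of_lemmaPrime_of_isNewformOf`: period homology, Manin,
Hecke at `r = 0` and `r = 3/D`; `3 ∤ N_E` from good reduction at `3`). No sorry of its own. -/
theorem muOneSignThree_of_stubs : ∀ (W : WeierstrassCurve ℚ) [W.IsElliptic] [W.IsGloballyMinimal],
    ClassX7 W 3 → ¬ W.HasCM → W.frobeniusTrace 3 = 0 → ¬ Surj W 3 →
    ∀ [NeZero (W.conductorNorm ℤ)] (f : CuspForm (Gamma0 (W.conductorNorm ℤ)) 2),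
    IsNewformOf W f → ∃ (n : ℕ) (u : (ZMod (3 ^ (n + 1)))ˣ),
      ‖((ratPlusSymbol f (((u : ZMod (3 ^ (n + 1))).val : ℚ) / (3 : ℚ) ^ (n + 1)) : ℚ) : ℚ_[3])‖ = 1 := by
  intro W _ _ hX _ hap _ _ f hf
  have hgood : W.HasGoodReductionAtPrime 3 := hX.1.1
  have h3N : ¬ 3 ∣ W.conductorNorm ℤ := not_dvd_level_of_isNewformOf hf hgood
  exact Summit.BirchSwinnertonDyer.BirchSwinnertonDyer.Theorems.SmallImageHeckePrimeMu.exists_unit_norm_ratPlusSymbol_eq_one_of_lemmaPrime_of_isNewformOf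
    f (by decide) hf hgood hap (lemmaPrimeThree_of_stubs 3 rfl (W.conductorNorm ℤ) h3N)

/-- stub (v6; the one-sign analytic μ-rider AT p ≥ 5, VERBATIM k3-c4x's `hμan₀` restricted to `5 ≤ p`): for the conductor-level
newform of `E`, SOME signed Pollack function has unit content (OPEN class-wide = OS₀(N,p) of EG-REDUCTION-g8 §5; per pair ONE unit
ω⁰ orbit sum Σ_η [ηγ^s/p^{n+1}]⁺ via `SmallImageOrbitSumMu.exists_sign_hasUnitContent_of_norm_coeff_eq_one`). -/
theorem stub_muOneSign_ns_ge5 : ∀ (W : WeierstrassCurve ℚ) [W.IsElliptic] [W.IsGloballyMinimal] (p : ℕ) [Fact p.Prime],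
    5 ≤ p → ClassX7 W p → ¬ W.HasCM → W.frobeniusTrace p = 0 → ¬ Surj W p →
    ∀ [NeZero (W.conductorNorm ℤ)] (f : CuspForm (Gamma0 (W.conductorNorm ℤ)) 2),
    IsNewformOf W f → ∃ (ε₀ : ℤˣ) (L₀ : IwasawaAlgebra p),
      IsSignedPAdicLFunction f p ε₀ L₀ ∧ HasUnitContent L₀ := by
  sorry

/-- **The v5 rider `stub_muOneSign_ns` DERIVED from the two v6 stubs** (case split `p = 3` / `5 ≤ p` for an odd prime; at
`p = 3` the unit plus symbol gives a signed function with unit content by the landed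
`SmallImageOrbitSumMuThree.exists_sign_hasUnitContent_three_of_norm_ratPlusSymbol_eq_one`, existence of `L_p^ε` being the tree THEOREM
`pollack_exists_plusMinusPAdicLFunction_holds`). No sorry of its own. -/
theorem muOneSign_of_stubs : ∀ (W : WeierstrassCurve ℚ) [W.IsElliptic] [W.IsGloballyMinimal] (p : ℕ) [Fact p.Prime],
    p ≠ 2 → ClassX7 W p → ¬ W.HasCM → W.frobeniusTrace p = 0 → ¬ Surj W p →
    ∀ [NeZero (W.conductorNorm ℤ)] (f : CuspForm (Gamma0 (W.conductorNorm ℤ)) 2),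
    IsNewformOf W f → ∃ (ε₀ : ℤˣ) (L₀ : IwasawaAlgebra p),
      IsSignedPAdicLFunction f p ε₀ L₀ ∧ HasUnitContent L₀ := by
  intro W _ _ p _ hp2 hX hCM hap hs _ f hf
  have hpP : p.Prime := Fact.out
  by_cases h3 : p = 3
  · subst h3
    obtain ⟨n, u, hunit⟩ := muOneSignThree_of_stubs W hX hCM hap hs f hf
    exact Summit.BirchSwinnertonDyer.BirchSwinnertonDyer.Theorems.SmallImageOrbitSumMuThree.exists_sign_hasUnitContent_three_of_norm_ratPlusSymbol_eq_one
      f hf hX.1.1 hap u hunit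
  · have h5 : 5 ≤ p := by
      rcases hpP.eq_two_or_odd' with h | h
      · exact absurd h hp2
      · have h2 := hpP.two_le
        by_contra hlt
        interval_cases p <;> simp_all (config := {decide := true})
    exact stub_muOneSign_ns_ge5 W p h5 hX hCM hap hs f hf

/-- stub (HELD, cite-only — PUBLISHED named facts / one reviewed construction fact, none with `_holds`): Kobayashi
Thm 4.1, Thm 1.2, the period unit at `p ≥ 5` and at `p = 3`, the Coleman–Kato ζ construction fact (Thm 6.2/6.3/7.3),
modularity with parametrisation, BCS 2025 Prop 4.2.2. -/
theorem stub_publishedInputs_ns :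
    Literature.NumberTheory.EllipticCurves.Kobayashi2003.thm41_signedCharIdeal_divisibility ∧
    Literature.NumberTheory.EllipticCurves.Kobayashi2003.thm12_signedSelmerDual_finite_torsion ∧
    Literature.NumberTheory.EllipticCurves.realPeriodRat_eq_unit_mul_plusPeriod ∧
    Literature.NumberTheory.EllipticCurves.realPeriodRat_eq_unit_mul_plusPeriod_three ∧
    Literature.NumberTheory.EllipticCurves.Kobayashi2003.thm62_63_73_signedColemanKato_zeta ∧
    Literature.NumberTheory.EllipticCurves.ModularForms.nonempty_modularParametrizationData ∧
    Literature.NumberTheory.EllipticCurves.BurungaleCastellaSkinner2025.prop422_greenbergAnyRoot_hasUnitContent_minus := by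
  sorry

/-- stub (PRE, cite-only — PREPRINT binders, arXiv:2409.01350v2): BSTW Thm 6.17 common Katz frame (GSF) and the
signed two-variable package (P1)–(P3). -/
theorem stub_preprintInputs_ns :
    Literature.NumberTheory.EllipticCurves.BurungaleSkinnerTianWan2024.thm617_exists_commonKatzFrame_isGreenbergLFunctionAnyRoot₂_supersingular_PRE ∧
    Literature.NumberTheory.EllipticCurves.BurungaleSkinnerTianWan2024.props118_27_519_exists_signedTwoVariablePackage_supersingular_PRE := by
  sorry

/-- stub (residual at `p = 3`): the Eisenstein half on the crux's `p = 3` rows (the two-variable PRE binders carry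
`5 ≤ p`). -/
theorem stub_threeLower_ns : ∀ (W : WeierstrassCurve ℚ) [W.IsElliptic] [W.IsGloballyMinimal] (p : ℕ) [Fact p.Prime],
    p = 3 → ClassX7 W p → ¬ W.HasCM → W.frobeniusTrace p = 0 → ¬ Surj W p →
    ∃ ε : ℤˣ, Summit.BirchSwinnertonDyer.Rank1Residual.Supersingular.KobayashiLowerDivisibility W p ε := by
  sorry

/-- composition = THE SKELETON: the crux BY NAME from the seven stubs, by the landed
`SmallImageAcnsCrux.kobayashiMainConjectureSmallImage_of_acns` (5 ≤ p: T3 + one-sign μ + held inputs ⇒ lower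
at the rider's sign, saturation at every sign from the same rider; p = 3: the residual Eisenstein half +
saturation), the rider supplied by `muOneSign_of_stubs` (v6). No sorry of its own. -/
theorem KobayashiMainConjectureSmallImage_of :
    Summit.BirchSwinnertonDyer.BirchSwinnertonDyer.Theses.SignedLowerHalves.KobayashiMainConjectureSmallImage := by
  obtain ⟨h41, h12, h5, h3, hCK, hmodP, h422⟩ := stub_publishedInputs_ns
  obtain ⟨hGF, hpkg⟩ := stub_preprintInputs_ns
  exact Summit.BirchSwinnertonDyer.BirchSwinnertonDyer.Theorems.SmallImageAcnsCrux.kobayashiMainConjectureSmallImage_of_acns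
    hCK h12 h41 h5 h3 hmodP h422 hpkg hGF canonical_ns_of_stubs muOneSign_of_stubs stub_threeLower_ns

/-! ### Axiom audit (gen 10): which derived theorems of v8 are now sorry-free -/
#print axioms stub_SpGenerates_three
#print axioms lemmaPrimeThree_of_stubs
#print axioms muOneSignThree_of_stubs
#print axioms muOneSign_of_stubs
#print axioms KobayashiMainConjectureSmallImage_of

end Summit.BirchSwinnertonDyer.BirchSwinnertonDyer.Cruxes.KobayashiMainConjectureSmallImage.BirthAcnsV8CheckG10

end
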